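import Literature.Analysis.FluidPDE.NSHopfEnergy
import Literature.Analysis.FunctionSpaces.TorusFourierSeries
import HarnessLib

/-!
# Navier–Stokes on `𝕋³`: the weak form for the limit of a Hopf–Galerkin scheme and the
  discharge of the named fact `NS.hopf_galerkin_limit` (parts 3–4 of 4)

Trunk: FluidKinetic. Final module of the proof of `NS.hopf_galerkin_limit`
(`Literature/Analysis/FluidPDE/NSHopfGalerkin`; Hopf 1951, §4; Robinson–Rodrigo–Sadowski 2016,
Thm. 4.4 Step 4, Thm. 4.6, Cor. 4.7, Thm. 4.11; Constantin–Foias 1988, Ch. 8, Theorem (Leray)),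
continuing `NSHopfLimit` (compactness, limit field, Friedrichs) and `NSHopfEnergy` (energy
inequalities, weak continuity, energy class), in two parts with their own section documentation:

1. **Weak form** — integration by parts in time at the Galerkin level, the Galerkin equations
   tested against truncated test fields along transversal frames of each frequency, and the
   passage to the limit using the uniform truncation error of smooth test fields;
2. **Assembly** — `IsHopfGalerkinScheme.isLerayHopfOn_limit`, `exists_isGlobalLerayHopf`,
   `hopf_galerkin_limit_holds : hopf_galerkin_limit`.

Theorem-only module.

## References

* E. Hopf, *Über die Anfangswertaufgabe für die hydrodynamischen Grundgleichungen*, Math. Nachr.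
  4 (1951), 213–231, §4.
* J. C. Robinson, J. L. Rodrigo, W. Sadowski, *The three-dimensional Navier–Stokes equations*
  (CUP 2016), Def. 2.1, Lemma 2.9, Def. 3.3, Thm. 4.4 Step 4 (pp. 76–77), (4.5), Thm. 4.6,
  Cor. 4.7, Thm. 4.11.
* P. Constantin, C. Foias, *Navier–Stokes Equations* (Chicago 1988), Ch. 4 (periodic case),
  Ch. 8, (8.5), Theorem (Leray), pp. 45–48.
-/

/-!
# Part 1 — the weak form of the equations for the limit of a Hopf–Galerkin scheme

Trunk: FluidKinetic. Fourth part of the proof of the named fact `NS.hopf_galerkin_limit`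
(`Literature/Analysis/FluidPDE/NSHopfGalerkin`), continuing `NSHopfLimit` and `NSHopfEnergy`: the limit `u` of a Hopf–Galerkin scheme satisfies the weak (pressure-free) form of
the forced Navier–Stokes equations against every divergence-free space–time test field
(Robinson–Rodrigo–Sadowski 2016, Thm. 4.4, Step 4, pp. 76–77; Constantin–Foias 1988, Ch. 8,
proof of Theorem (Leray), pp. 45–47; Hopf 1951, §4).

* **Integration by parts in time at the Galerkin level** (`intervalIntegral_mode_ibp`): for a
  Galerkin mode `a` and a `C¹` scalar `λ` with `λ(T) = 0`,
  `∫₀ᵀ (λ' ⟪U n, a⟫ + λ (⟪U n, (U n·∇)a⟫ + ν⟪U n, Δa⟫ + ⟪F n, a⟫)) = -λ(0) ⟪u₀, a⟫`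
  (the tested Galerkin equations make `t ↦ ⟪U n t, a⟫` a `C¹` function; product rule; FTC).
* **The Galerkin equations in weak form against truncated tests** (`galerkin_weak_identity`):
  the truncation `P_M ψ(t)` (`M = N n`) of a divergence-free test field is a finite combination
  `∑ᵢ λᵢ(t) aᵢ` of fixed Galerkin modes `aᵢ` (single real modes along a transversal frame of
  each frequency, `Torus.exists_transversal_frame`) with smooth real coefficients; summing the
  one-mode identities gives
  `∫₀ᵀ ∫ (⟪U n, P_M ∂ₜψ⟫ + ⟪U n, (U n·∇)P_M ψ⟫ + ν⟪U n, ΔP_M ψ⟫ + ⟪F n, P_M ψ⟫) + ∫⟪u₀, P_M ψ(0)⟫ = 0`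
  (RRS (4.5) tested against `P_n ψ`, p. 76).
* **Passage to the limit** (`weak_form_limit`): replacing `P_{N n} ψ` by `ψ` costs
  `O(sup |ψ - P_{N n} ψ|)` with derivatives (uniform truncation error of smooth fields,
  `Torus.exists_norm_sub_fourierTruncate_le_spaceTime`, times the uniform `L²ₜₓ` bounds), and
  `n → ∞` in the resulting expression uses the strong `L²ₜₓ` convergence `U n → u`, `F n → f`
  (`tendsto_lintegral_enorm_sub_sq`), the nonlinear term included (RRS p. 77; CF p. 46).

## References

* E. Hopf, *Über die Anfangswertaufgabe für die hydrodynamischen Grundgleichungen*, Math. Nachr.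
  4 (1951), 213–231, §4.
* J. C. Robinson, J. L. Rodrigo, W. Sadowski, *The three-dimensional Navier–Stokes equations*
  (CUP 2016), Def. 3.3, Thm. 4.4 Step 4 (pp. 76–77), (4.5), Lemma 4.1.
* P. Constantin, C. Foias, *Navier–Stokes Equations* (Chicago 1988), Ch. 8, (8.5), pp. 45–47.
-/

noncomputable section

open MeasureTheory TopologicalSpace Set Function Filter Topology UnitAddTorus
open scoped InnerProductSpace RealInnerProductSpace ENNReal NNReal

namespace Literature.Analysis.FluidPDE

/-! ## Linear algebra: a transversal frame at each frequency -/

namespace Torus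

variable {d : Type*} [Fintype d] [DecidableEq d]

/-- **A real spanning frame of the transversal space at a frequency.** For `k ∈ ℤ^d` there are
vectors `v l ∈ ℂ^d`, `l ∈ d × Bool`, all transversal to `k` (`∑ⱼ kⱼ (v l)ⱼ = 0`), such that every
transversal `z` is the real combination `z = ∑_l c_l(z) • v l` with the real coordinates
`c_{(j,ff)}(z) = Re zⱼ`, `c_{(j,tt)}(z) = Im zⱼ`. Construction: `w_j = e_j - (kⱼ/|k|²) k` (the Leray
symbol applied to the standard basis; for `k = 0`, `w_j = e_j`), `v (j, ff) = w_j`,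
`v (j, tt) = i w_j`, and `z = ∑ⱼ zⱼ w_j` for transversal `z` (Robinson–Rodrigo–Sadowski 2016,
Def. 2.1 / Lemma 2.9; Constantin–Foias 1988, Ch. 4, periodic case). [cite: RobinsonRodrigoSadowski2016, Def. 2.1] -/
theorem exists_transversal_frame (k : d → ℤ) :
    ∃ v : d × Bool → EuclideanSpace ℂ d,
      (∀ l, ∑ j, (k j : ℂ) * v l j = 0) ∧
      ∀ z : EuclideanSpace ℂ d, ∑ j, (k j : ℂ) * z j = 0 →
        z = ∑ l : d × Bool, (if l.2 then (z l.1).im else (z l.1).re) • v l := by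
  -- the frequency vector and `|k|²`
  set K : EuclideanSpace ℂ d := WithLp.toLp 2 (fun i => (k i : ℂ)) with hK
  have hKi : ∀ i, K i = (k i : ℂ) := fun i => rfl
  set q : ℂ := ((FunctionSpaces.Torus.freqNormSq k : ℝ) : ℂ) with hq
  have hKK : ∑ i, (k i : ℂ) * K i = q := by
    simp only [hKi, hq, FunctionSpaces.Torus.freqNormSq, Complex.ofReal_sum]
    refine Finset.sum_congr rfl fun i _ => ?_
    push_cast
    ring
  -- the Leray images of the standard basis
  set w : d → EuclideanSpace ℂ d := fun j => EuclideanSpace.single j (1 : ℂ) - ((k j : ℂ) / q) • K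
    with hw
  have hwT : ∀ j, ∑ i, (k i : ℂ) * w j i = 0 := by
    intro j
    by_cases hk : k = 0
    · subst hk; simp
    have hq0 : q ≠ 0 := by
      rw [hq, Ne, Complex.ofReal_eq_zero]
      intro h
      have h' := (Finset.sum_eq_zero_iff_of_nonneg fun i _ => sq_nonneg ((k i : ℝ))).1 h
      apply hk
      funext i
      have := h' i (Finset.mem_univ i)
      exact_mod_cast pow_eq_zero_iff (n := 2) two_ne_zero |>.1 this
    have hs : ∑ i, (k i : ℂ) * (EuclideanSpace.single j (1 : ℂ)) i = (k j : ℂ) := by simp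
    have hsum : ∑ i, (k i : ℂ) * w j i =
        ∑ i, (k i : ℂ) * (EuclideanSpace.single j (1 : ℂ)) i - (k j : ℂ) / q * ∑ i, (k i : ℂ) * K i := by
      simp only [hw, PiLp.sub_apply, PiLp.smul_apply, smul_eq_mul, mul_sub, Finset.sum_sub_distrib,
        Finset.mul_sum]
      congr 1
      exact Finset.sum_congr rfl fun i _ => by ring
    rw [hsum, hs, hKK, div_mul_cancel₀ _ hq0, sub_self]
  -- transversal vectors are combinations of the `w_j`
  have hdec : ∀ z : EuclideanSpace ℂ d, ∑ j, (k j : ℂ) * z j = 0 → ∑ j, z j • w j = z := by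
    intro z hz
    have h1 : ∑ j, z j • w j = ∑ j, z j • EuclideanSpace.single j (1 : ℂ) -
        (∑ j, z j * ((k j : ℂ) / q)) • K := by
      simp only [hw, smul_sub, Finset.sum_sub_distrib, smul_smul, Finset.sum_smul]
    rw [h1, EuclideanSpace.sum_apply_smul_single]
    have h2 : ∑ j, z j * ((k j : ℂ) / q) = (∑ j, (k j : ℂ) * z j) / q := by
      rw [Finset.sum_div]
      exact Finset.sum_congr rfl fun j _ => by ring
    rw [h2, hz, zero_div, zero_smul, sub_zero]
  refine ⟨fun l => if l.2 then Complex.I • w l.1 else w l.1, fun l => ?_, fun z hz => ?_⟩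
  · rcases l with ⟨j, b⟩
    cases b
    · simpa using hwT j
    · simp only [ite_true, PiLp.smul_apply, smul_eq_mul]
      have : ∑ i, (k i : ℂ) * (Complex.I * w j i) = Complex.I * ∑ i, (k i : ℂ) * w j i := by
        rw [Finset.mul_sum]; exact Finset.sum_congr rfl fun i _ => by ring
      rw [this, hwT j, mul_zero]
  · conv_lhs => rw [← hdec z hz]
    rw [Fintype.sum_prod_type]
    refine Finset.sum_congr rfl fun j _ => ?_
    simp only [Fintype.univ_bool, Finset.sum_insert (show true ∉ ({false} : Finset Bool) by decide),
      Finset.sum_singleton, ite_true, Bool.false_eq_true, ite_false]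
    -- `z_j • w = (Im z_j) • (I • w) + (Re z_j) • w`
    rw [← Complex.coe_smul, ← Complex.coe_smul, smul_smul, ← add_smul]
    congr 1
    rw [add_comm]
    exact (Complex.re_add_im (z j)).symm

omit [DecidableEq d] in
/-- Real linearity of the single real modes in the coefficient: real scalars. [folklore] -/
theorem realTrigPoly_singleton_real_smul (k : d → ℤ) (c : ℝ) (z : EuclideanSpace ℂ d)
    (x : UnitAddTorus d) :
    FunctionSpaces.Torus.realTrigPoly {k} (fun _ => (c : ℂ) • z) x = c • FunctionSpaces.Torus.realTrigPoly {k} (fun _ => z) x := by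
  rw [FunctionSpaces.Torus.realTrigPoly_singleton_apply, FunctionSpaces.Torus.realTrigPoly_singleton_apply, smul_comm, Complex.coe_smul,
    map_smul]

omit [DecidableEq d] in
/-- Real linearity of the single real modes in the coefficient: finite sums. [folklore] -/
theorem realTrigPoly_singleton_sum {ι : Type*} (s : Finset ι) (k : d → ℤ)
    (z : ι → EuclideanSpace ℂ d) (x : UnitAddTorus d) :
    FunctionSpaces.Torus.realTrigPoly {k} (fun _ => ∑ i ∈ s, z i) x = ∑ i ∈ s, FunctionSpaces.Torus.realTrigPoly {k} (fun _ => z i) x := by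
  simp only [FunctionSpaces.Torus.realTrigPoly_singleton_apply, Finset.smul_sum, map_sum]

/-! ## Linearity of the spatial operators over finite real combinations of smooth fields -/

omit [DecidableEq d] in
/-- Smoothness of a finite real combination of smooth fields. [folklore] -/
theorem isSmooth_finset_sum_smul {ι : Type*} (s : Finset ι) (c : ι → ℝ)
    {a : ι → UnitAddTorus d → EuclideanSpace ℝ d} (ha : ∀ i, FunctionSpaces.Torus.IsSmooth (a i)) :
    FunctionSpaces.Torus.IsSmooth (fun y => ∑ i ∈ s, c i • a i y) := by
  unfold FunctionSpaces.Torus.IsSmooth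
  have : FunctionSpaces.Torus.lift (fun y => ∑ i ∈ s, c i • a i y) = fun z => ∑ i ∈ s, c i • FunctionSpaces.Torus.lift (a i) z := by
    funext z; rfl
  rw [this]
  exact ContDiff.sum fun i _ => (ha i).const_smul (c i)

/-- Partial derivatives of a finite real combination of smooth fields. [folklore] -/
theorem partialDeriv_finset_sum_smul {ι : Type*} (s : Finset ι) (c : ι → ℝ)
    {a : ι → UnitAddTorus d → EuclideanSpace ℝ d} (ha : ∀ i, FunctionSpaces.Torus.IsSmooth (a i)) (j : d)
    (x : UnitAddTorus d) :
    FunctionSpaces.Torus.partialDeriv j (fun y => ∑ i ∈ s, c i • a i y) x = ∑ i ∈ s, c i • FunctionSpaces.Torus.partialDeriv j (a i) x := by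
  have h : HasDerivAt (fun t : ℝ => ∑ i ∈ s, c i • a i (x + FunctionSpaces.Torus.proj (t • EuclideanSpace.single j (1 : ℝ))))
      (∑ i ∈ s, c i • FunctionSpaces.Torus.partialDeriv j (a i) x) 0 :=
    HasDerivAt.fun_sum fun i _ => ((ha i).hasDerivAt_line_zero j x).fun_const_smul (c i)
  exact h.deriv

/-- The convective derivative along `u` of a finite real combination of smooth fields. [folklore] -/
theorem convect_finset_sum_smul {ι : Type*} (s : Finset ι) (c : ι → ℝ)
    {a : ι → UnitAddTorus d → EuclideanSpace ℝ d} (ha : ∀ i, FunctionSpaces.Torus.IsSmooth (a i))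
    (u : UnitAddTorus d → EuclideanSpace ℝ d) (x : UnitAddTorus d) :
    FunctionSpaces.Torus.convect u (fun y => ∑ i ∈ s, c i • a i y) x = ∑ i ∈ s, c i • FunctionSpaces.Torus.convect u (a i) x := by
  unfold FunctionSpaces.Torus.convect
  rw [FunctionSpaces.Torus.fderiv_apply_eq_sum_partialDeriv ((isSmooth_finset_sum_smul s c ha).isContDiff (by simp))]
  simp_rw [partialDeriv_finset_sum_smul s c ha, FunctionSpaces.Torus.fderiv_apply_eq_sum_partialDeriv
    ((ha _).isContDiff (by simp)), Finset.smul_sum]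
  rw [Finset.sum_comm]
  refine Finset.sum_congr rfl fun i _ => Finset.sum_congr rfl fun l _ => ?_
  rw [smul_comm]

/-- The Laplacian of a finite real combination of smooth fields (`Δ = ∑ⱼ ∂ⱼ∂ⱼ`). [folklore] -/
theorem laplacian_finset_sum_smul {ι : Type*} (s : Finset ι) (c : ι → ℝ)
    {a : ι → UnitAddTorus d → EuclideanSpace ℝ d} (ha : ∀ i, FunctionSpaces.Torus.IsSmooth (a i)) (x : UnitAddTorus d) :
    FunctionSpaces.Torus.laplacian (fun y => ∑ i ∈ s, c i • a i y) x = ∑ i ∈ s, c i • FunctionSpaces.Torus.laplacian (a i) x := by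
  rw [FunctionSpaces.Torus.laplacian_eq_sum_partialDeriv_partialDeriv (isSmooth_finset_sum_smul s c ha)]
  have h1 : ∀ j : d, FunctionSpaces.Torus.partialDeriv j (fun y => ∑ i ∈ s, c i • a i y) =
      fun y => ∑ i ∈ s, c i • FunctionSpaces.Torus.partialDeriv j (a i) y := fun j =>
    funext fun y => partialDeriv_finset_sum_smul s c ha j y
  simp_rw [h1]
  have h2 : ∀ j : d, FunctionSpaces.Torus.partialDeriv j (fun y => ∑ i ∈ s, c i • FunctionSpaces.Torus.partialDeriv j (a i) y) x =
      ∑ i ∈ s, c i • FunctionSpaces.Torus.partialDeriv j (FunctionSpaces.Torus.partialDeriv j (a i)) x := fun j =>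
    partialDeriv_finset_sum_smul s c (fun i => (ha i).partialDeriv j) j x
  simp_rw [h2]
  rw [Finset.sum_comm]
  refine Finset.sum_congr rfl fun i _ => ?_
  rw [FunctionSpaces.Torus.laplacian_eq_sum_partialDeriv_partialDeriv (ha i), Finset.smul_sum]

end Torus

section NS

variable {d : Type*} [Fintype d] [DecidableEq d]

variable {ν : ℝ} {f : ℝ → UnitAddTorus d → EuclideanSpace ℝ d}
  {u₀ : UnitAddTorus d → EuclideanSpace ℝ d} {N : ℕ → ℕ}
  {F U : ℕ → ℝ → UnitAddTorus d → EuclideanSpace ℝ d}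
  {u : ℝ → UnitAddTorus d → EuclideanSpace ℝ d}

/-! ## Integration by parts in time at the Galerkin level -/

section IBP

/-- The tested Galerkin right-hand side `t ↦ ∫(⟪U n,(U n·∇)a⟫ + ν⟪U n, Δa⟫ + ⟪F n, a⟫)` is
continuous on `[0, ∞)` for a smooth field `a`. [folklore] -/
theorem IsHopfGalerkinScheme.continuousOn_galerkin_rhs (hS : IsHopfGalerkinScheme ν f u₀ N F U)
    (n : ℕ) {a : UnitAddTorus d → EuclideanSpace ℝ d} (ha : FunctionSpaces.Torus.IsSmooth a) :
    ContinuousOn (fun t => ∫ x, (⟪U n t x, FunctionSpaces.Torus.convect (U n t) a x⟫ +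
      ν * ⟪U n t x, FunctionSpaces.Torus.laplacian a x⟫ + ⟪F n t x, a x⟫)) (Set.Ici 0) := by
  -- continuity of the space–time lift of the integrand
  have hU := hS.continuousOn n
  have hF := hS.continuousOn_force n
  have hconv : ContinuousOn (FunctionSpaces.Torus.stLift fun t x => FunctionSpaces.Torus.convect (U n t) a x) (Set.Ici 0 ×ˢ Set.univ) := by
    have h : (FunctionSpaces.Torus.stLift fun t x => FunctionSpaces.Torus.convect (U n t) a x) =
        fun p => ∑ i, (FunctionSpaces.Torus.stLift (U n) p) i • FunctionSpaces.Torus.partialDeriv i a (FunctionSpaces.Torus.proj p.2) := by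
      funext p
      exact FunctionSpaces.Torus.fderiv_apply_eq_sum_partialDeriv (ha.isContDiff (by simp)) _ _
    rw [h]
    refine continuousOn_finsetSum _ fun i _ => ?_
    have hc1 : ContinuousOn (fun p : ℝ × EuclideanSpace ℝ d => (FunctionSpaces.Torus.stLift (U n) p) i)
        (Set.Ici 0 ×ˢ Set.univ) :=
      (EuclideanSpace.proj (𝕜 := ℝ) i).continuous.comp_continuousOn hU
    have hc2 : ContinuousOn (fun p : ℝ × EuclideanSpace ℝ d => FunctionSpaces.Torus.partialDeriv i a (FunctionSpaces.Torus.proj p.2))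
        (Set.Ici 0 ×ˢ Set.univ) :=
      ((ha.partialDeriv i).continuous.comp (FunctionSpaces.Torus.continuous_proj.comp continuous_snd)).continuousOn
    exact hc1.smul hc2
  have hlap : ContinuousOn (FunctionSpaces.Torus.stLift fun (_ : ℝ) x => FunctionSpaces.Torus.laplacian a x) (Set.Ici 0 ×ˢ Set.univ) :=
    (ha.laplacian.continuous.comp (FunctionSpaces.Torus.continuous_proj.comp continuous_snd)).continuousOn
  have hcst : ContinuousOn (FunctionSpaces.Torus.stLift fun (_ : ℝ) x => a x) (Set.Ici 0 ×ˢ Set.univ) :=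
    (ha.continuous.comp (FunctionSpaces.Torus.continuous_proj.comp continuous_snd)).continuousOn
  have h1 := FunctionSpaces.Torus.continuousOn_integral_inner_of_continuousOn_stLift hU hconv
  have h2 := FunctionSpaces.Torus.continuousOn_integral_inner_of_continuousOn_stLift hU hlap
  have h3 := FunctionSpaces.Torus.continuousOn_integral_inner_of_continuousOn_stLift hF hcst
  have hsum := (h1.add (h2.const_smul ν)).add h3
  refine hsum.congr fun t ht => ?_
  have ht0 : 0 ≤ t := ht
  have hcU : Continuous (U n t) := hS.continuous_slice n ht0
  have hcF : Continuous (F n t) := hS.continuous_force_slice n ht0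
  have i1 : Integrable (fun x => ⟪U n t x, FunctionSpaces.Torus.convect (U n t) a x⟫) volume := by
    have h : (fun x => FunctionSpaces.Torus.convect (U n t) a x) =
        fun x => ∑ i, (U n t x) i • FunctionSpaces.Torus.partialDeriv i a x := by
      funext x; exact FunctionSpaces.Torus.fderiv_apply_eq_sum_partialDeriv (ha.isContDiff (by simp)) _ _
    have hcc : Continuous (fun x => FunctionSpaces.Torus.convect (U n t) a x) := by
      rw [h]
      exact continuous_finsetSum _ fun i _ =>
        (((EuclideanSpace.proj (𝕜 := ℝ) i).continuous.comp hcU).smul (ha.partialDeriv i).continuous)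
    exact (hcU.inner hcc).integrable_unitAddTorus
  have i2 : Integrable (fun x => ⟪U n t x, FunctionSpaces.Torus.laplacian a x⟫) volume :=
    (hcU.inner ha.laplacian.continuous).integrable_unitAddTorus
  have i3 : Integrable (fun x => ⟪F n t x, a x⟫) volume := (hcF.inner ha.continuous).integrable_unitAddTorus
  simp only [Pi.add_apply, Pi.smul_apply, smul_eq_mul]
  have i12 : Integrable (fun x => ⟪U n t x, FunctionSpaces.Torus.convect (U n t) a x⟫ +
      ν * ⟪U n t x, FunctionSpaces.Torus.laplacian a x⟫) volume := i1.add (i2.const_mul ν)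
  rw [integral_add i12 i3, integral_add i1 (i2.const_mul ν), integral_const_mul]

/-- The tested Galerkin pairing `t ↦ ∫ ⟪U n t, a⟫` is continuous on `[0, ∞)`. [folklore] -/
theorem IsHopfGalerkinScheme.continuousOn_galerkin_pairing (hS : IsHopfGalerkinScheme ν f u₀ N F U)
    (n : ℕ) {a : UnitAddTorus d → EuclideanSpace ℝ d} (ha : FunctionSpaces.Torus.IsSmooth a) :
    ContinuousOn (fun t => ∫ x, ⟪U n t x, a x⟫) (Set.Ici 0) :=
  FunctionSpaces.Torus.continuousOn_integral_inner_of_continuousOn_stLift (hS.continuousOn n)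
    (ha.continuous.comp (FunctionSpaces.Torus.continuous_proj.comp continuous_snd)).continuousOn

/-- The tested Galerkin pairing has the tested right-hand side as derivative at every `t > 0`
(FTC for the clause `galerkin`, whose right-hand side is continuous). [folklore] -/
theorem IsHopfGalerkinScheme.hasDerivAt_galerkin_pairing (hS : IsHopfGalerkinScheme ν f u₀ N F U)
    (n : ℕ) {a : UnitAddTorus d → EuclideanSpace ℝ d} (ha : IsGalerkinMode (N n) a) {t : ℝ}
    (ht : 0 < t) :
    HasDerivAt (fun s => ∫ x, ⟪U n s x, a x⟫)
      (∫ x, (⟪U n t x, FunctionSpaces.Torus.convect (U n t) a x⟫ + ν * ⟪U n t x, FunctionSpaces.Torus.laplacian a x⟫ +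
        ⟪F n t x, a x⟫)) t := by
  set h : ℝ → ℝ := fun τ => ∫ x, (⟪U n τ x, FunctionSpaces.Torus.convect (U n τ) a x⟫ +
    ν * ⟪U n τ x, FunctionSpaces.Torus.laplacian a x⟫ + ⟪F n τ x, a x⟫) with hh
  have hcont : ContinuousOn h (Set.Ici 0) := hS.continuousOn_galerkin_rhs n ha.isSmooth
  have hcontI : ContinuousOn h (Set.Ioi 0) := hcont.mono Set.Ioi_subset_Ici_self
  -- the primitive has derivative `h t`
  have hprim : HasDerivAt (fun s => ∫ τ in (0 : ℝ)..s, h τ) (h t) t := by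
    refine intervalIntegral.integral_hasDerivAt_right ?_ ?_ ?_
    · exact (hcont.mono Icc_subset_Ici_self).intervalIntegrable_of_Icc ht.le
    · exact hcontI.stronglyMeasurableAtFilter isOpen_Ioi t ht
    · exact hcontI.continuousAt (Ioi_mem_nhds ht)
  -- the pairing agrees with `G 0 + primitive` near `t`
  have heq : (fun s => ∫ x, ⟪U n s x, a x⟫) =ᶠ[𝓝 t]
      fun s => (∫ x, ⟪U n 0 x, a x⟫) + ∫ τ in (0 : ℝ)..s, h τ := by
    filter_upwards [Ioi_mem_nhds ht] with s hs
    have := hS.galerkin n a ha 0 s le_rfl (le_of_lt hs)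
    simp only [hh]
    linarith
  exact (hprim.const_add _).congr_of_eventuallyEq heq

/-- **Integration by parts in time at the Galerkin level** (Robinson–Rodrigo–Sadowski 2016,
Thm. 4.4 Step 4, (4.5) tested against `λ(t) a`, p. 76; Constantin–Foias 1988, (8.5)): for a
Galerkin mode `a` of order `N n`, a scalar `λ` with continuous derivative `λ'` and `λ(T) = 0`,
`∫₀ᵀ (λ' ⟪U n, a⟫ + λ (⟪U n, (U n·∇)a⟫ + ν⟪U n, Δa⟫ + ⟪F n, a⟫)) dt = -λ(0) ∫⟪u₀, a⟫`.
[cite: RobinsonRodrigoSadowski2016, Thm. 4.4 Step 4 (4.5)] -/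
theorem IsHopfGalerkinScheme.intervalIntegral_mode_ibp (hS : IsHopfGalerkinScheme ν f u₀ N F U)
    (n : ℕ) {a : UnitAddTorus d → EuclideanSpace ℝ d} (ha : IsGalerkinMode (N n) a)
    {lam lam' : ℝ → ℝ} (hlam : ∀ t, HasDerivAt lam (lam' t) t) (hlam' : Continuous lam')
    {T : ℝ} (hT : 0 < T) (hlamT : lam T = 0) :
    ∫ t in (0 : ℝ)..T, (lam' t * (∫ x, ⟪U n t x, a x⟫) +
        lam t * ∫ x, (⟪U n t x, FunctionSpaces.Torus.convect (U n t) a x⟫ + ν * ⟪U n t x, FunctionSpaces.Torus.laplacian a x⟫ +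
          ⟪F n t x, a x⟫)) =
      -(lam 0 * ∫ x, ⟪u₀ x, a x⟫) := by
  have hG : ContinuousOn (fun t => ∫ x, ⟪U n t x, a x⟫) (Icc 0 T) :=
    (hS.continuousOn_galerkin_pairing n ha.isSmooth).mono Icc_subset_Ici_self
  have hh : ContinuousOn (fun t => ∫ x, (⟪U n t x, FunctionSpaces.Torus.convect (U n t) a x⟫ +
      ν * ⟪U n t x, FunctionSpaces.Torus.laplacian a x⟫ + ⟪F n t x, a x⟫)) (Icc 0 T) :=
    (hS.continuousOn_galerkin_rhs n ha.isSmooth).mono Icc_subset_Ici_self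
  have hlamc : Continuous lam := continuous_iff_continuousAt.2 fun t => (hlam t).continuousAt
  have h := intervalIntegral.integral_eq_sub_of_hasDeriv_right_of_le hT.le
    (f := fun t => lam t * ∫ x, ⟪U n t x, a x⟫)
    (f' := fun t => lam' t * (∫ x, ⟪U n t x, a x⟫) + lam t * ∫ x, (⟪U n t x, FunctionSpaces.Torus.convect (U n t) a x⟫ +
      ν * ⟪U n t x, FunctionSpaces.Torus.laplacian a x⟫ + ⟪F n t x, a x⟫))
    (hlamc.continuousOn.mul hG) (fun t ht => ?_) ?_
  · rw [h, hlamT, zero_mul, zero_sub, hS.initial_inner n a ha]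
  · exact ((hlam t).mul (hS.hasDerivAt_galerkin_pairing n ha ht.1)).hasDerivWithinAt
  · exact ((hlam'.continuousOn.mul hG).add (hlamc.continuousOn.mul hh)).intervalIntegrable_of_Icc hT.le

end IBP

/-! ## The Galerkin equations in weak form against truncated test fields -/

section GalerkinWeak

omit [DecidableEq d] in
/-- A space–time test field on `[0, T)` vanishes at (and after) time `T`. [folklore] -/
theorem _root_.Literature.Analysis.FunctionSpaces.Torus.IsSpaceTimeTest.eq_zero_of_le {T : ℝ} {ψ : ℝ → UnitAddTorus d → EuclideanSpace ℝ d}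
    (hψ : FunctionSpaces.Torus.IsSpaceTimeTest T ψ) {t : ℝ} (ht : T ≤ t) : ψ t = 0 := by
  obtain ⟨-, T', hT', h⟩ := hψ
  exact h t (hT'.le.trans ht)

omit [DecidableEq d] in
/-- The Fourier coefficients of a test field are continuous in time on all of `ℝ`. [folklore] -/
theorem _root_.Literature.Analysis.FunctionSpaces.Torus.IsSpaceTimeTest.continuous_mFourierCoeff {T : ℝ}
    {ψ : ℝ → UnitAddTorus d → EuclideanSpace ℝ d} (hψ : FunctionSpaces.Torus.IsSpaceTimeTest T ψ) (k : d → ℤ) :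
    Continuous fun t => mFourierCoeff (FunctionSpaces.EuclideanSpace.complexify ∘ ψ t) k := by
  rw [← continuousOn_univ]
  have h : ContinuousOn (FunctionSpaces.Torus.stLift ψ) (Set.univ ×ˢ Set.univ) := hψ.1.continuous.continuousOn
  exact FunctionSpaces.Torus.continuousOn_mFourierCoeff_of_continuousOn_stLift h k

/-- **The time derivative of a divergence-free test field has transversal Fourier coefficients**
(differentiate the identically vanishing `t ↦ ∑ⱼ kⱼ 𝓕(ψ t)(k)ⱼ`). [folklore] -/
theorem _root_.Literature.Analysis.FunctionSpaces.Torus.IsSpaceTimeTest.sum_mul_mFourierCoeff_timeDeriv_eq_zero {T : ℝ}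
    {ψ : ℝ → UnitAddTorus d → EuclideanSpace ℝ d} (hψ : FunctionSpaces.Torus.IsSpaceTimeTest T ψ)
    (hdiv : FunctionSpaces.Torus.IsDivFreeTest ψ) (k : d → ℤ) (t : ℝ) :
    ∑ j, (k j : ℂ) * mFourierCoeff (FunctionSpaces.EuclideanSpace.complexify ∘ FunctionSpaces.Torus.timeDeriv ψ t) k j = 0 := by
  have hg := FunctionSpaces.Torus.hasDerivAt_mFourierCoeff_slice (hψ.isSmoothSpaceTimeOn Set.univ) k t
  -- derivative of the linear combination of coordinates
  have hsum : HasDerivAt (fun s => ∑ j, (k j : ℂ) * mFourierCoeff (FunctionSpaces.EuclideanSpace.complexify ∘ ψ s) k j)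
      (∑ j, (k j : ℂ) * mFourierCoeff (FunctionSpaces.EuclideanSpace.complexify ∘ FunctionSpaces.Torus.timeDeriv ψ t) k j) t := by
    refine HasDerivAt.fun_sum fun j _ => HasDerivAt.const_mul _ ?_
    exact (((EuclideanSpace.proj j : EuclideanSpace ℂ d →L[ℂ] ℂ).restrictScalars ℝ).hasFDerivAt.comp_hasDerivAt
      t hg)
  -- the combination vanishes identically
  have hzero : (fun s => ∑ j, (k j : ℂ) * mFourierCoeff (FunctionSpaces.EuclideanSpace.complexify ∘ ψ s) k j) =
      fun _ => (0 : ℂ) :=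
    funext fun s => FunctionSpaces.Torus.IsDivFree.sum_mul_mFourierCoeff_eq_zero (hψ.isSmooth_slice s) (hdiv s) k
  rw [hzero] at hsum
  exact hsum.unique (hasDerivAt_const t (0 : ℂ))

omit [Fintype d] [DecidableEq d] in
/-- The real coordinate maps of the transversal frame as continuous `ℝ`-linear functionals:
`c_{(j, tt)} = Im ∘ projⱼ`, `c_{(j, ff)} = Re ∘ projⱼ`. [folklore] -/
theorem Torus.exists_coordCLM [Fintype d] (l : d × Bool) :
    ∃ C : EuclideanSpace ℂ d →L[ℝ] ℝ, ∀ z, C z = if l.2 then (z l.1).im else (z l.1).re := by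
  rcases l with ⟨j, b⟩
  cases b
  · exact ⟨Complex.reCLM.comp ((EuclideanSpace.proj j : EuclideanSpace ℂ d →L[ℂ] ℂ).restrictScalars ℝ),
      fun z => rfl⟩
  · exact ⟨Complex.imCLM.comp ((EuclideanSpace.proj j : EuclideanSpace ℂ d →L[ℂ] ℂ).restrictScalars ℝ),
      fun z => rfl⟩

/-- **Truncations along a transversal frame.** If `v k` is a transversal frame at every
frequency (as in `Torus.exists_transversal_frame`) and every Fourier coefficient of `b` is
transversal, then `P_M b` is the finite real combination of the single modes
`a_{(k,l)} = Re (e_k • v k l)`, `k ∈ ball M`, with coefficients the frame coordinates of `b̂(k)`. [folklore] -/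
theorem Torus.fourierTruncate_eq_sum_frame {v : (d → ℤ) → d × Bool → EuclideanSpace ℂ d}
    (hv : ∀ k (z : EuclideanSpace ℂ d), ∑ j, (k j : ℂ) * z j = 0 →
      z = ∑ l : d × Bool, (if l.2 then (z l.1).im else (z l.1).re) • v k l)
    {b : UnitAddTorus d → EuclideanSpace ℝ d}
    (hb : ∀ k, ∑ j, (k j : ℂ) * mFourierCoeff (FunctionSpaces.EuclideanSpace.complexify ∘ b) k j = 0) (M : ℕ)
    (x : UnitAddTorus d) :
    FunctionSpaces.Torus.fourierTruncate M b x =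
      ∑ i ∈ FunctionSpaces.Torus.freqBall M ×ˢ (Finset.univ : Finset (d × Bool)),
        (if i.2.2 then (mFourierCoeff (FunctionSpaces.EuclideanSpace.complexify ∘ b) i.1 i.2.1).im
          else (mFourierCoeff (FunctionSpaces.EuclideanSpace.complexify ∘ b) i.1 i.2.1).re) •
          FunctionSpaces.Torus.realTrigPoly {i.1} (fun _ => v i.1 i.2) x := by
  rw [FunctionSpaces.Torus.fourierTruncate_eq, FunctionSpaces.Torus.realTrigPoly_apply_eq_sum, Finset.sum_product]
  refine Finset.sum_congr rfl fun k _ => ?_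
  conv_lhs => rw [hv k _ (hb k)]
  rw [Finset.smul_sum, map_sum]
  refine Finset.sum_congr rfl fun l _ => ?_
  dsimp only
  rw [← Complex.coe_smul, ← FunctionSpaces.Torus.realTrigPoly_singleton_apply k (fun _ => ((if l.2 then
      (mFourierCoeff (FunctionSpaces.EuclideanSpace.complexify ∘ b) k l.1).im
      else (mFourierCoeff (FunctionSpaces.EuclideanSpace.complexify ∘ b) k l.1).re : ℝ) : ℂ) • v k l) x,
    Torus.realTrigPoly_singleton_real_smul]

/-- **The Galerkin equations in weak form against truncated test fields**
(Robinson–Rodrigo–Sadowski 2016, Thm. 4.4 Step 4, (4.5) tested against `P_n ψ`, p. 76;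
Constantin–Foias 1988, (8.5), p. 45): for every divergence-free space–time test field `ψ` on
`[0, T)` and every `n`, with `M = N n`,
`∫₀ᵀ ∫ (⟪U n, P_M ∂ₜψ⟫ + ⟪U n, (U n·∇)P_M ψ⟫ + ν⟪U n, Δ P_M ψ⟫ + ⟪F n, P_M ψ⟫) + ∫ ⟪u₀, P_M ψ(0)⟫ = 0`.
Proof: expand `P_M ψ(t) = ∑ᵢ λᵢ(t) aᵢ` along transversal frames (`fourierTruncate_eq_sum_frame`;
`λᵢ` smooth with `λᵢ' =` coordinates of `𝓕(∂ₜψ t)`, `hasDerivAt_mFourierCoeff_slice`), and sum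
the one-mode identities `intervalIntegral_mode_ibp`. [cite: RobinsonRodrigoSadowski2016, Thm. 4.4 Step 4 (4.5)] -/
theorem IsHopfGalerkinScheme.galerkin_weak_identity (hS : IsHopfGalerkinScheme ν f u₀ N F U)
    (hu₀ : MemLp u₀ 2 volume) (n : ℕ) {T : ℝ} (hT : 0 < T)
    {ψ : ℝ → UnitAddTorus d → EuclideanSpace ℝ d} (hψ : FunctionSpaces.Torus.IsSpaceTimeTest T ψ)
    (hdiv : FunctionSpaces.Torus.IsDivFreeTest ψ) :
    (∫ t in (0 : ℝ)..T, ∫ x,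
        (⟪U n t x, FunctionSpaces.Torus.fourierTruncate (N n) (FunctionSpaces.Torus.timeDeriv ψ t) x⟫ +
          ⟪U n t x, FunctionSpaces.Torus.convect (U n t) (FunctionSpaces.Torus.fourierTruncate (N n) (ψ t)) x⟫ +
          ν * ⟪U n t x, FunctionSpaces.Torus.laplacian (FunctionSpaces.Torus.fourierTruncate (N n) (ψ t)) x⟫ +
          ⟪F n t x, FunctionSpaces.Torus.fourierTruncate (N n) (ψ t) x⟫)) +
      ∫ x, ⟪u₀ x, FunctionSpaces.Torus.fourierTruncate (N n) (ψ 0) x⟫ = 0 := by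
  classical
  -- transversal frames and coordinate functionals
  choose v hvT hv using fun k : d → ℤ => Torus.exists_transversal_frame (d := d) k
  choose C hC using fun l : d × Bool => Torus.exists_coordCLM (d := d) l
  set I : Finset ((d → ℤ) × (d × Bool)) := FunctionSpaces.Torus.freqBall (N n) ×ˢ Finset.univ with hI
  set a : (d → ℤ) × (d × Bool) → UnitAddTorus d → EuclideanSpace ℝ d :=
    fun i => FunctionSpaces.Torus.realTrigPoly {i.1} (fun _ => v i.1 i.2) with ha
  have ha_mode : ∀ i ∈ I, IsGalerkinMode (N n) (a i) := by
    intro i hi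
    exact isGalerkinMode_realTrigPoly_singleton (Finset.mem_product.1 hi).1 (hvT i.1 i.2)
  have ha_smooth : ∀ i, FunctionSpaces.Torus.IsSmooth (a i) := fun i => FunctionSpaces.Torus.isSmooth_realTrigPoly _ _
  -- coefficients and their derivatives
  set lam : ℝ → (d → ℤ) × (d × Bool) → ℝ :=
    fun t i => C i.2 (mFourierCoeff (FunctionSpaces.EuclideanSpace.complexify ∘ ψ t) i.1) with hlam
  set lam' : ℝ → (d → ℤ) × (d × Bool) → ℝ :=
    fun t i => C i.2 (mFourierCoeff (FunctionSpaces.EuclideanSpace.complexify ∘ FunctionSpaces.Torus.timeDeriv ψ t) i.1) with hlam'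
  have hderiv : ∀ i t, HasDerivAt (fun s => lam s i) (lam' t i) t := fun i t =>
    (C i.2).hasFDerivAt.comp_hasDerivAt t
      (FunctionSpaces.Torus.hasDerivAt_mFourierCoeff_slice (hψ.isSmoothSpaceTimeOn Set.univ) i.1 t)
  have hcont' : ∀ i, Continuous fun t => lam' t i := fun i =>
    (C i.2).continuous.comp (hψ.timeDeriv.continuous_mFourierCoeff i.1)
  have hlamT : ∀ i, lam T i = 0 := by
    intro i
    simp only [hlam, hψ.eq_zero_of_le le_rfl]
    have : mFourierCoeff (FunctionSpaces.EuclideanSpace.complexify ∘ (0 : UnitAddTorus d → EuclideanSpace ℝ d)) i.1 = 0 := by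
      simp [mFourierCoeff]
    rw [this, map_zero]
  -- the representations of the truncations
  have hR : ∀ t x, FunctionSpaces.Torus.fourierTruncate (N n) (ψ t) x = ∑ i ∈ I, lam t i • a i x := by
    intro t x
    rw [Torus.fourierTruncate_eq_sum_frame hv (fun k =>
      FunctionSpaces.Torus.IsDivFree.sum_mul_mFourierCoeff_eq_zero (hψ.isSmooth_slice t) (hdiv t) k)]
    refine Finset.sum_congr rfl fun i _ => ?_
    simp only [hlam, ha, hC]
  have hR' : ∀ t x, FunctionSpaces.Torus.fourierTruncate (N n) (FunctionSpaces.Torus.timeDeriv ψ t) x = ∑ i ∈ I, lam' t i • a i x := by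
    intro t x
    rw [Torus.fourierTruncate_eq_sum_frame hv (fun k =>
      hψ.sum_mul_mFourierCoeff_timeDeriv_eq_zero hdiv k t)]
    refine Finset.sum_congr rfl fun i _ => ?_
    simp only [hlam', ha, hC]
  have hRfun : ∀ t, FunctionSpaces.Torus.fourierTruncate (N n) (ψ t) = fun x => ∑ i ∈ I, lam t i • a i x :=
    fun t => funext (hR t)
  -- the one-mode identities, summed
  have hsum := Finset.sum_congr rfl fun i (hi : i ∈ I) =>
    hS.intervalIntegral_mode_ibp n (ha_mode i hi) (hderiv i) (hcont' i) hT (hlamT i)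
  -- continuity facts for interval integrability
  have hG : ∀ i, ContinuousOn (fun t => ∫ x, ⟪U n t x, a i x⟫) (Set.Icc 0 T) := fun i =>
    (hS.continuousOn_galerkin_pairing n (ha_smooth i)).mono Set.Icc_subset_Ici_self
  have hh : ∀ i, ContinuousOn (fun t => ∫ x, (⟪U n t x, FunctionSpaces.Torus.convect (U n t) (a i) x⟫ +
      ν * ⟪U n t x, FunctionSpaces.Torus.laplacian (a i) x⟫ + ⟪F n t x, a i x⟫)) (Set.Icc 0 T) := fun i =>
    (hS.continuousOn_galerkin_rhs n (ha_smooth i)).mono Set.Icc_subset_Ici_self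
  have hlamc : ∀ i, Continuous fun t => lam t i := fun i =>
    continuous_iff_continuousAt.2 fun t => (hderiv i t).continuousAt
  have hint : ∀ i ∈ I, IntervalIntegrable (fun t => lam' t i * (∫ x, ⟪U n t x, a i x⟫) +
      lam t i * ∫ x, (⟪U n t x, FunctionSpaces.Torus.convect (U n t) (a i) x⟫ +
        ν * ⟪U n t x, FunctionSpaces.Torus.laplacian (a i) x⟫ + ⟪F n t x, a i x⟫)) volume 0 T := fun i _ =>
    (((hcont' i).continuousOn.mul (hG i)).add ((hlamc i).continuousOn.mul (hh i))).intervalIntegrable_of_Icc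
      hT.le
  rw [← intervalIntegral.integral_finsetSum hint] at hsum
  -- identify the right-hand side
  have hrhs : ∑ i ∈ I, -(lam 0 i * ∫ x, ⟪u₀ x, a i x⟫) =
      -∫ x, ⟪u₀ x, FunctionSpaces.Torus.fourierTruncate (N n) (ψ 0) x⟫ := by
    rw [Finset.sum_neg_distrib, neg_inj]
    simp_rw [hR 0, inner_sum, inner_smul_right]
    rw [integral_finsetSum I fun i _ =>
      (FunctionSpaces.Torus.integrable_inner_of_continuous (hu₀.integrable one_le_two) (ha_smooth i).continuous).const_mul _]
    exact Finset.sum_congr rfl fun i _ => (integral_const_mul _ _).symm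
  -- identify the left-hand side, slice by slice
  have hlhs : ∀ t ∈ Set.Icc 0 T, ∑ i ∈ I, (lam' t i * (∫ x, ⟪U n t x, a i x⟫) +
      lam t i * ∫ x, (⟪U n t x, FunctionSpaces.Torus.convect (U n t) (a i) x⟫ +
        ν * ⟪U n t x, FunctionSpaces.Torus.laplacian (a i) x⟫ + ⟪F n t x, a i x⟫)) =
      ∫ x, (⟪U n t x, FunctionSpaces.Torus.fourierTruncate (N n) (FunctionSpaces.Torus.timeDeriv ψ t) x⟫ +
        ⟪U n t x, FunctionSpaces.Torus.convect (U n t) (FunctionSpaces.Torus.fourierTruncate (N n) (ψ t)) x⟫ +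
        ν * ⟪U n t x, FunctionSpaces.Torus.laplacian (FunctionSpaces.Torus.fourierTruncate (N n) (ψ t)) x⟫ +
        ⟪F n t x, FunctionSpaces.Torus.fourierTruncate (N n) (ψ t) x⟫) := by
    intro t ht
    have ht0 : 0 ≤ t := ht.1
    have hcU : Continuous (U n t) := hS.continuous_slice n ht0
    have hcF : Continuous (F n t) := hS.continuous_force_slice n ht0
    -- integrability of the mode integrands
    have hconv_cont : ∀ i, Continuous fun x => FunctionSpaces.Torus.convect (U n t) (a i) x := by
      intro i
      have h : (fun x => FunctionSpaces.Torus.convect (U n t) (a i) x) =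
          fun x => ∑ j, (U n t x) j • FunctionSpaces.Torus.partialDeriv j (a i) x := by
        funext x; exact FunctionSpaces.Torus.fderiv_apply_eq_sum_partialDeriv ((ha_smooth i).isContDiff (by simp)) _ _
      rw [h]
      exact continuous_finsetSum _ fun j _ =>
        (((EuclideanSpace.proj (𝕜 := ℝ) j).continuous.comp hcU).smul ((ha_smooth i).partialDeriv j).continuous)
    have iA : ∀ i, Integrable (fun x => ⟪U n t x, a i x⟫) volume := fun i =>
      (hcU.inner (ha_smooth i).continuous).integrable_unitAddTorus
    have iB : ∀ i, Integrable (fun x => ⟪U n t x, FunctionSpaces.Torus.convect (U n t) (a i) x⟫ +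
        ν * ⟪U n t x, FunctionSpaces.Torus.laplacian (a i) x⟫ + ⟪F n t x, a i x⟫) volume := fun i =>
      (((hcU.inner (hconv_cont i)).add ((hcU.inner (ha_smooth i).laplacian.continuous).const_smul ν |>.congr
        (fun x => by simp))).add (hcF.inner (ha_smooth i).continuous)).integrable_unitAddTorus
    -- pull everything inside one integral
    have hstep : ∀ i ∈ I, lam' t i * (∫ x, ⟪U n t x, a i x⟫) +
        lam t i * ∫ x, (⟪U n t x, FunctionSpaces.Torus.convect (U n t) (a i) x⟫ +
          ν * ⟪U n t x, FunctionSpaces.Torus.laplacian (a i) x⟫ + ⟪F n t x, a i x⟫) =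
        ∫ x, (lam' t i * ⟪U n t x, a i x⟫ + lam t i * (⟪U n t x, FunctionSpaces.Torus.convect (U n t) (a i) x⟫ +
          ν * ⟪U n t x, FunctionSpaces.Torus.laplacian (a i) x⟫ + ⟪F n t x, a i x⟫)) := by
      intro i _
      rw [integral_add ((iA i).const_mul _) ((iB i).const_mul _), integral_const_mul, integral_const_mul]
    have iAB : ∀ i ∈ I, Integrable (fun x => lam' t i * ⟪U n t x, a i x⟫ +
        lam t i * (⟪U n t x, FunctionSpaces.Torus.convect (U n t) (a i) x⟫ +
          ν * ⟪U n t x, FunctionSpaces.Torus.laplacian (a i) x⟫ + ⟪F n t x, a i x⟫)) volume := fun i _ =>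
      ((iA i).const_mul _).add ((iB i).const_mul _)
    rw [Finset.sum_congr rfl hstep, ← integral_finsetSum I iAB]
    refine integral_congr_ae (ae_of_all _ fun x => ?_)
    -- pointwise algebra
    dsimp only
    rw [hR' t x, hRfun t, Torus.convect_finset_sum_smul I (lam t) ha_smooth,
      Torus.laplacian_finset_sum_smul I (lam t) ha_smooth]
    simp only [inner_sum, inner_smul_right, Finset.mul_sum, ← Finset.sum_add_distrib]
    refine Finset.sum_congr rfl fun i _ => ?_
    ring
  rw [intervalIntegral.integral_congr (fun t ht => hlhs t (by rwa [Set.uIcc_of_le hT.le] at ht))] at hsum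
  rw [hrhs] at hsum
  linarith

end GalerkinWeak

/-! ## The weak-form slice functional: pointwise and integrated estimates -/

section SliceFunctional

omit [Fintype d] [DecidableEq d] in
/-- **Pointwise estimate for differences of the weak-form integrand** (pure inner-product-space
algebra plus Young's inequality): with `D = U₁ - U₂`,
`(⟪U₁,p⟫ + ⟪U₁,A U₁⟫ + ν⟪U₁,L⟫ + ⟪F₁,q⟫) - (same with U₂, F₂) = ⟪D,p⟫ + ⟪D, A U₁⟫ + ⟪U₂, A D⟫ + ν⟪D,L⟫ + ⟪F₁-F₂,q⟫`,
each product bounded by `(2λ)⁻¹ a² + (λ/2) b²`. [folklore] -/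
theorem abs_weakIntegrand_sub_le {E : Type*} [NormedAddCommGroup E] [InnerProductSpace ℝ E]
    (U₁ U₂ F₁ F₂ p L q : E) (A : E →L[ℝ] E) {C : ℝ} (hC : ∀ w, ‖A w‖ ≤ C * ‖w‖) (ν : ℝ) {lam : ℝ}
    (hlam : 0 < lam) :
    |(⟪U₁, p⟫ + ⟪U₁, A U₁⟫ + ν * ⟪U₁, L⟫ + ⟪F₁, q⟫) - (⟪U₂, p⟫ + ⟪U₂, A U₂⟫ + ν * ⟪U₂, L⟫ + ⟪F₂, q⟫)| ≤
      (2 * lam)⁻¹ * (4 * ‖U₁ - U₂‖ ^ 2 + ‖F₁ - F₂‖ ^ 2) +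
        lam / 2 * (‖p‖ ^ 2 + C ^ 2 * ‖U₁‖ ^ 2 + C ^ 2 * ‖U₂‖ ^ 2 + ν ^ 2 * ‖L‖ ^ 2 + ‖q‖ ^ 2) := by
  have hdiff : (⟪U₁, p⟫ + ⟪U₁, A U₁⟫ + ν * ⟪U₁, L⟫ + ⟪F₁, q⟫) -
      (⟪U₂, p⟫ + ⟪U₂, A U₂⟫ + ν * ⟪U₂, L⟫ + ⟪F₂, q⟫) =
      ⟪U₁ - U₂, p⟫ + (⟪U₁ - U₂, A U₁⟫ + ⟪U₂, A (U₁ - U₂)⟫) + ν * ⟪U₁ - U₂, L⟫ + ⟪F₁ - F₂, q⟫ := by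
    simp only [inner_sub_left, inner_sub_right, map_sub]
    ring
  rw [hdiff]
  have b1 : |⟪U₁ - U₂, p⟫| ≤ (2 * lam)⁻¹ * ‖U₁ - U₂‖ ^ 2 + lam / 2 * ‖p‖ ^ 2 := by
    refine (abs_real_inner_le_norm _ _).trans ?_
    have := Torus.mul_le_young ‖p‖ ‖U₁ - U₂‖ hlam
    linarith [mul_comm ‖U₁ - U₂‖ ‖p‖]
  have b2 : |⟪U₁ - U₂, A U₁⟫| ≤ (2 * lam)⁻¹ * ‖U₁ - U₂‖ ^ 2 + lam / 2 * (C ^ 2 * ‖U₁‖ ^ 2) := by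
    refine (abs_real_inner_le_norm _ _).trans ?_
    have h1 : ‖U₁ - U₂‖ * ‖A U₁‖ ≤ ‖U₁ - U₂‖ * (C * ‖U₁‖) :=
      mul_le_mul_of_nonneg_left (hC U₁) (norm_nonneg _)
    have h2 := Torus.mul_le_young (C * ‖U₁‖) ‖U₁ - U₂‖ hlam
    nlinarith
  have b3 : |⟪U₂, A (U₁ - U₂)⟫| ≤ (2 * lam)⁻¹ * ‖U₁ - U₂‖ ^ 2 + lam / 2 * (C ^ 2 * ‖U₂‖ ^ 2) := by
    refine (abs_real_inner_le_norm _ _).trans ?_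
    have h1 : ‖U₂‖ * ‖A (U₁ - U₂)‖ ≤ ‖U₂‖ * (C * ‖U₁ - U₂‖) :=
      mul_le_mul_of_nonneg_left (hC _) (norm_nonneg _)
    have h2 := Torus.mul_le_young (C * ‖U₂‖) ‖U₁ - U₂‖ hlam
    nlinarith
  have b4 : |ν * ⟪U₁ - U₂, L⟫| ≤ (2 * lam)⁻¹ * ‖U₁ - U₂‖ ^ 2 + lam / 2 * (ν ^ 2 * ‖L‖ ^ 2) := by
    rw [abs_mul]
    have h1 : |ν| * |⟪U₁ - U₂, L⟫| ≤ |ν| * (‖U₁ - U₂‖ * ‖L‖) :=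
      mul_le_mul_of_nonneg_left (abs_real_inner_le_norm _ _) (abs_nonneg ν)
    have h2 := Torus.mul_le_young (|ν| * ‖L‖) ‖U₁ - U₂‖ hlam
    have h3 : (|ν| * ‖L‖) ^ 2 = ν ^ 2 * ‖L‖ ^ 2 := by rw [mul_pow, sq_abs]
    nlinarith
  have b5 : |⟪F₁ - F₂, q⟫| ≤ (2 * lam)⁻¹ * ‖F₁ - F₂‖ ^ 2 + lam / 2 * ‖q‖ ^ 2 := by
    refine (abs_real_inner_le_norm _ _).trans ?_
    have := Torus.mul_le_young ‖q‖ ‖F₁ - F₂‖ hlam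
    linarith [mul_comm ‖F₁ - F₂‖ ‖q‖]
  calc |⟪U₁ - U₂, p⟫ + (⟪U₁ - U₂, A U₁⟫ + ⟪U₂, A (U₁ - U₂)⟫) + ν * ⟪U₁ - U₂, L⟫ + ⟪F₁ - F₂, q⟫|
      ≤ |⟪U₁ - U₂, p⟫| + (|⟪U₁ - U₂, A U₁⟫| + |⟪U₂, A (U₁ - U₂)⟫|) + |ν * ⟪U₁ - U₂, L⟫| +
          |⟪F₁ - F₂, q⟫| := by
        refine (abs_add_le _ _).trans (add_le_add ((abs_add_le _ _).trans (add_le_add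
          ((abs_add_le _ _).trans (add_le_add le_rfl (abs_add_le _ _))) le_rfl)) le_rfl)
    _ ≤ _ := by nlinarith [b1, b2, b3, b4, b5]

/-- Measurability of the convective pairing `x ↦ ⟪U x, ((U·∇)b)(x)⟫` for an a.e. strongly
measurable field `U` and a smooth `b` (`(U·∇)b = ∑ᵢ Uᵢ ∂ᵢ b`). [folklore] -/
theorem Torus.aestronglyMeasurable_inner_convect {U : UnitAddTorus d → EuclideanSpace ℝ d}
    (hU : AEStronglyMeasurable U volume) {b : UnitAddTorus d → EuclideanSpace ℝ d} (hb : FunctionSpaces.Torus.IsSmooth b) :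
    AEStronglyMeasurable (fun x => ⟪U x, FunctionSpaces.Torus.convect U b x⟫) volume := by
  have h : (fun x => FunctionSpaces.Torus.convect U b x) = fun x => ∑ i, (U x) i • FunctionSpaces.Torus.partialDeriv i b x := by
    funext x; exact FunctionSpaces.Torus.fderiv_apply_eq_sum_partialDeriv (hb.isContDiff (by simp)) _ _
  have hconv : AEStronglyMeasurable (fun x => FunctionSpaces.Torus.convect U b x) volume := by
    rw [h]
    exact Finset.aestronglyMeasurable_fun_sum _ fun i _ =>
      ((EuclideanSpace.proj (𝕜 := ℝ) i).continuous.comp_aestronglyMeasurable hU).smul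
        (hb.partialDeriv i).continuous.aestronglyMeasurable
  exact hU.inner hconv

/-- **Integrability of the weak-form integrand** on a slice: for `U, F ∈ L²(T^d)`, smooth `b` and
continuous `p`, `L`, the function `⟪U, p⟫ + ⟪U, (U·∇)b⟫ + ν⟪U, L⟫ + ⟪F, b⟫` is integrable
(`|⟪U, (U·∇)b⟫| ≤ C‖U‖²`). [folklore] -/
theorem Torus.integrable_weakIntegrand {U F : UnitAddTorus d → EuclideanSpace ℝ d}
    (hU : MemLp U 2 volume) (hF : MemLp F 2 volume) {b p L : UnitAddTorus d → EuclideanSpace ℝ d}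
    (hb : FunctionSpaces.Torus.IsSmooth b) (hp : Continuous p) (hL : Continuous L) (ν : ℝ) :
    Integrable (fun x => ⟪U x, p x⟫ + ⟪U x, FunctionSpaces.Torus.convect U b x⟫ + ν * ⟪U x, L x⟫ + ⟪F x, b x⟫) volume := by
  obtain ⟨C, hC⟩ := isCompact_univ.exists_bound_of_continuousOn
    (continuous_finsetSum Finset.univ fun i _ => (hb.partialDeriv i).continuous.norm).continuousOn
  have i1 : Integrable (fun x => ⟪U x, p x⟫) volume :=
    FunctionSpaces.Torus.integrable_inner_of_continuous (hU.integrable one_le_two) hp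
  have i2 : Integrable (fun x => ⟪U x, FunctionSpaces.Torus.convect U b x⟫) volume := by
    refine Integrable.mono' ((hU.integrable_norm_pow two_ne_zero).const_mul |C|)
      (Torus.aestronglyMeasurable_inner_convect hU.1 hb) (ae_of_all _ fun x => ?_)
    rw [Real.norm_eq_abs]
    refine (abs_real_inner_le_norm _ _).trans ?_
    have h1 := FunctionSpaces.Torus.norm_convect_le U (hb.isContDiff (by simp)) x
    have h2 : ∑ i, ‖FunctionSpaces.Torus.partialDeriv i b x‖ ≤ |C| := by
      have := hC x (mem_univ x)
      rw [Real.norm_eq_abs, abs_of_nonneg (Finset.sum_nonneg fun i _ => norm_nonneg _)] at this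
      exact this.trans (le_abs_self C)
    calc ‖U x‖ * ‖FunctionSpaces.Torus.convect U b x‖ ≤ ‖U x‖ * (‖U x‖ * |C|) := by
          refine mul_le_mul_of_nonneg_left (h1.trans ?_) (norm_nonneg _)
          exact mul_le_mul_of_nonneg_left h2 (norm_nonneg _)
      _ = |C| * ‖U x‖ ^ 2 := by ring
  have i3 : Integrable (fun x => ⟪U x, L x⟫) volume :=
    FunctionSpaces.Torus.integrable_inner_of_continuous (hU.integrable one_le_two) hL
  have i4 : Integrable (fun x => ⟪F x, b x⟫) volume :=
    FunctionSpaces.Torus.integrable_inner_of_continuous (hF.integrable one_le_two) hb.continuous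
  exact ((i1.add i2).add (i3.const_mul ν)).add i4

omit [Fintype d] [DecidableEq d] in
/-- `ofReal` of a square of a norm. [folklore] -/
theorem _root_.ENNReal.ofReal_norm_sq {E : Type*} [NormedAddCommGroup E] (v : E) :
    ENNReal.ofReal (‖v‖ ^ 2) = ‖v‖ₑ ^ 2 := by
  rw [← ofReal_norm, ENNReal.ofReal_pow (norm_nonneg _)]

/-- **Slice estimate for the weak-form functional** (the single analytic inequality behind the
passage to the limit; Robinson–Rodrigo–Sadowski 2016, Thm. 4.4 Step 4, p. 77; Constantin–Foias
1988, p. 46): for `U₁, U₂, F₁, F₂ ∈ L²(T^d)`, a smooth test slice `b` with `∑ᵢ ‖∂ᵢ b‖ ≤ C`,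
`‖b‖ ≤ K_q`, and continuous `p`, `L` with `‖p‖ ≤ K_p`, `‖L‖ ≤ K_L`, and every `λ > 0`,
`‖Φ(U₁,F₁) - Φ(U₂,F₂)‖ₑ ≤ (2λ)⁻¹ (4‖U₁-U₂‖² + ‖F₁-F₂‖²) + (λ/2)(K_p² + ν²K_L² + K_q² + C²(‖U₁‖² + ‖U₂‖²))`
where `Φ(U,F) = ∫ (⟪U,p⟫ + ⟪U,(U·∇)b⟫ + ν⟪U,L⟫ + ⟪F,b⟫)` and the norms on the right are `L²`
norms. [cite: RobinsonRodrigoSadowski2016, Thm. 4.4 Step 4] -/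
theorem Torus.enorm_sliceFunctional_sub_le {U₁ U₂ F₁ F₂ : UnitAddTorus d → EuclideanSpace ℝ d}
    (hU₁ : MemLp U₁ 2 volume) (hU₂ : MemLp U₂ 2 volume) (hF₁ : MemLp F₁ 2 volume)
    (hF₂ : MemLp F₂ 2 volume) {b p L : UnitAddTorus d → EuclideanSpace ℝ d} (hb : FunctionSpaces.Torus.IsSmooth b)
    (hp : Continuous p) (hL : Continuous L) {C Kp KL Kq : ℝ}
    (hC : ∀ x, ∑ i, ‖FunctionSpaces.Torus.partialDeriv i b x‖ ≤ C) (hKp : ∀ x, ‖p x‖ ≤ Kp) (hKL : ∀ x, ‖L x‖ ≤ KL)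
    (hKq : ∀ x, ‖b x‖ ≤ Kq) (ν : ℝ) {lam : ℝ} (hlam : 0 < lam) :
    ‖(∫ x, (⟪U₁ x, p x⟫ + ⟪U₁ x, FunctionSpaces.Torus.convect U₁ b x⟫ + ν * ⟪U₁ x, L x⟫ + ⟪F₁ x, b x⟫)) -
        ∫ x, (⟪U₂ x, p x⟫ + ⟪U₂ x, FunctionSpaces.Torus.convect U₂ b x⟫ + ν * ⟪U₂ x, L x⟫ + ⟪F₂ x, b x⟫)‖ₑ ≤
      ENNReal.ofReal (2 * lam)⁻¹ * (4 * (∫⁻ x, ‖U₁ x - U₂ x‖ₑ ^ 2) + ∫⁻ x, ‖F₁ x - F₂ x‖ₑ ^ 2) +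
        ENNReal.ofReal (lam / 2) * (ENNReal.ofReal (Kp ^ 2 + ν ^ 2 * KL ^ 2 + Kq ^ 2) +
          ENNReal.ofReal (C ^ 2) * ((∫⁻ x, ‖U₁ x‖ₑ ^ 2) + ∫⁻ x, ‖U₂ x‖ₑ ^ 2)) := by
  have i1 := Torus.integrable_weakIntegrand hU₁ hF₁ hb hp hL ν
  have i2 := Torus.integrable_weakIntegrand hU₂ hF₂ hb hp hL ν
  rw [← integral_sub i1 i2]
  refine (enorm_integral_le_lintegral_enorm _).trans ?_
  -- pointwise bound
  have hA : ∀ x w, ‖FunctionSpaces.Torus.fderiv b x w‖ ≤ C * ‖w‖ := by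
    intro x w
    calc ‖FunctionSpaces.Torus.fderiv b x w‖ ≤ ‖w‖ * ∑ i, ‖FunctionSpaces.Torus.partialDeriv i b x‖ :=
          FunctionSpaces.Torus.norm_fderiv_apply_le (hb.isContDiff (by simp)) x w
      _ ≤ ‖w‖ * C := mul_le_mul_of_nonneg_left (hC x) (norm_nonneg _)
      _ = C * ‖w‖ := mul_comm _ _
  have hpt : ∀ x, ‖(⟪U₁ x, p x⟫ + ⟪U₁ x, FunctionSpaces.Torus.convect U₁ b x⟫ + ν * ⟪U₁ x, L x⟫ + ⟪F₁ x, b x⟫) -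
      (⟪U₂ x, p x⟫ + ⟪U₂ x, FunctionSpaces.Torus.convect U₂ b x⟫ + ν * ⟪U₂ x, L x⟫ + ⟪F₂ x, b x⟫)‖ₑ ≤
      ENNReal.ofReal (2 * lam)⁻¹ * (4 * ‖U₁ x - U₂ x‖ₑ ^ 2 + ‖F₁ x - F₂ x‖ₑ ^ 2) +
        ENNReal.ofReal (lam / 2) * (ENNReal.ofReal (Kp ^ 2 + ν ^ 2 * KL ^ 2 + Kq ^ 2) +
          ENNReal.ofReal (C ^ 2) * (‖U₁ x‖ₑ ^ 2 + ‖U₂ x‖ₑ ^ 2)) := by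
    intro x
    have h := abs_weakIntegrand_sub_le (U₁ x) (U₂ x) (F₁ x) (F₂ x) (p x) (L x) (b x)
      (FunctionSpaces.Torus.fderiv b x) (hA x) ν hlam
    rw [Real.enorm_eq_ofReal_abs]
    refine (ENNReal.ofReal_le_ofReal h).trans ?_
    have hl0 : 0 ≤ (2 * lam)⁻¹ := by positivity
    have hl1 : 0 ≤ lam / 2 := by positivity
    rw [ENNReal.ofReal_add (by positivity) (by positivity), ENNReal.ofReal_mul hl0, ENNReal.ofReal_mul hl1,
      ENNReal.ofReal_add (by positivity) (by positivity),
      ENNReal.ofReal_mul (by norm_num : (0 : ℝ) ≤ 4), ENNReal.ofReal_ofNat, ENNReal.ofReal_norm_sq,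
      ENNReal.ofReal_norm_sq]
    refine add_le_add le_rfl (mul_le_mul' le_rfl ?_)
    have hsplit : ‖p x‖ ^ 2 + C ^ 2 * ‖U₁ x‖ ^ 2 + C ^ 2 * ‖U₂ x‖ ^ 2 + ν ^ 2 * ‖L x‖ ^ 2 + ‖b x‖ ^ 2 =
        (‖p x‖ ^ 2 + ν ^ 2 * ‖L x‖ ^ 2 + ‖b x‖ ^ 2) + C ^ 2 * (‖U₁ x‖ ^ 2 + ‖U₂ x‖ ^ 2) := by ring
    rw [hsplit, ENNReal.ofReal_add (by positivity) (by positivity), ENNReal.ofReal_mul (sq_nonneg C)]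
    have hU12 : ENNReal.ofReal (‖U₁ x‖ ^ 2 + ‖U₂ x‖ ^ 2) = ‖U₁ x‖ₑ ^ 2 + ‖U₂ x‖ₑ ^ 2 := by
      rw [ENNReal.ofReal_add (by positivity) (by positivity), ENNReal.ofReal_norm_sq, ENNReal.ofReal_norm_sq]
    rw [hU12]
    refine add_le_add (ENNReal.ofReal_le_ofReal ?_) le_rfl
    have e1 : ‖p x‖ ^ 2 ≤ Kp ^ 2 := pow_le_pow_left₀ (norm_nonneg _) (hKp x) 2
    have e2 : ‖L x‖ ^ 2 ≤ KL ^ 2 := pow_le_pow_left₀ (norm_nonneg _) (hKL x) 2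
    have e3 : ‖b x‖ ^ 2 ≤ Kq ^ 2 := pow_le_pow_left₀ (norm_nonneg _) (hKq x) 2
    nlinarith [sq_nonneg ν]
  refine (lintegral_mono fun x => hpt x).trans (le_of_eq ?_)
  -- integrate the bound
  have m1 : AEMeasurable (fun x => ‖U₁ x - U₂ x‖ₑ ^ 2) volume := (hU₁.1.sub hU₂.1).enorm.pow_const 2
  have m2 : AEMeasurable (fun x => ‖F₁ x - F₂ x‖ₑ ^ 2) volume := (hF₁.1.sub hF₂.1).enorm.pow_const 2
  have m3 : AEMeasurable (fun x => ‖U₁ x‖ₑ ^ 2) volume := hU₁.1.enorm.pow_const 2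
  have m4 : AEMeasurable (fun x => ‖U₂ x‖ₑ ^ 2) volume := hU₂.1.enorm.pow_const 2
  have m12 : AEMeasurable (fun x => 4 * ‖U₁ x - U₂ x‖ₑ ^ 2 + ‖F₁ x - F₂ x‖ₑ ^ 2) volume :=
    (m1.const_mul _).add m2
  have mA : AEMeasurable (fun x => ENNReal.ofReal (2 * lam)⁻¹ *
      (4 * ‖U₁ x - U₂ x‖ₑ ^ 2 + ‖F₁ x - F₂ x‖ₑ ^ 2)) volume := m12.const_mul _
  have m4' : AEMeasurable (fun x => 4 * ‖U₁ x - U₂ x‖ₑ ^ 2) volume := m1.const_mul _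
  rw [lintegral_add_left' mA, lintegral_const_mul'' _ m12, lintegral_add_left' m4',
    lintegral_const_mul'' _ m1, lintegral_const_mul' _ _ ENNReal.ofReal_ne_top,
    lintegral_add_left' aemeasurable_const, lintegral_const, measure_univ, mul_one,
    lintegral_const_mul' _ _ ENNReal.ofReal_ne_top, lintegral_add_left' m3]

end SliceFunctional

/-! ## Test-field data: continuity and sup bounds on `[0, T] × T^d` -/

section TestData

variable {T : ℝ} {ψ : ℝ → UnitAddTorus d → EuclideanSpace ℝ d}

/-- The Laplacian slices of a test field form a field smooth on `ℝ × T^d`. [folklore] -/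
theorem _root_.Literature.Analysis.FunctionSpaces.Torus.IsSpaceTimeTest.isSmoothSpaceTimeOn_laplacian (hψ : FunctionSpaces.Torus.IsSpaceTimeTest T ψ) :
    FunctionSpaces.Torus.IsSmoothSpaceTimeOn Set.univ (fun t => FunctionSpaces.Torus.laplacian (ψ t)) :=
  (hψ.isSmoothSpaceTimeOn Set.univ).laplacian uniqueDiffOn_univ

/-- The partial-derivative slices of a test field form a field smooth on `ℝ × T^d`. [folklore] -/
theorem _root_.Literature.Analysis.FunctionSpaces.Torus.IsSpaceTimeTest.isSmoothSpaceTimeOn_partialDeriv (hψ : FunctionSpaces.Torus.IsSpaceTimeTest T ψ)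
    (i : d) : FunctionSpaces.Torus.IsSmoothSpaceTimeOn Set.univ (fun t => FunctionSpaces.Torus.partialDeriv i (ψ t)) :=
  (hψ.isSmoothSpaceTimeOn Set.univ).partialDeriv uniqueDiffOn_univ i

omit [Fintype d] [DecidableEq d] in
/-- A field smooth on `ℝ × T^d` has a continuous space–time lift. [folklore] -/
theorem _root_.Literature.Analysis.FunctionSpaces.Torus.IsSmoothSpaceTimeOn.continuous_stLift_of_univ {F' : Type*} [NormedAddCommGroup F']
    [NormedSpace ℝ F'] [Fintype d] {w : ℝ → UnitAddTorus d → F'} (hw : FunctionSpaces.Torus.IsSmoothSpaceTimeOn Set.univ w) :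
    Continuous (FunctionSpaces.Torus.stLift w) := by
  have h := hw.continuousOn_stLift
  rwa [Set.univ_prod_univ, continuousOn_univ] at h

/-- **Uniform bounds for the test data on `[0, T] × T^d`**: sup bounds for `∂ₜψ`, `Δψ`, `ψ` and
`∑ᵢ ‖∂ᵢψ‖`. [folklore] -/
theorem _root_.Literature.Analysis.FunctionSpaces.Torus.IsSpaceTimeTest.exists_bounds (hψ : FunctionSpaces.Torus.IsSpaceTimeTest T ψ) :
    ∃ Kp KL Kq C : ℝ, 0 ≤ C ∧ (∀ t ∈ Set.Icc 0 T, ∀ x, ‖FunctionSpaces.Torus.timeDeriv ψ t x‖ ≤ Kp) ∧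
      (∀ t ∈ Set.Icc 0 T, ∀ x, ‖FunctionSpaces.Torus.laplacian (ψ t) x‖ ≤ KL) ∧
      (∀ t ∈ Set.Icc 0 T, ∀ x, ‖ψ t x‖ ≤ Kq) ∧
      ∀ t ∈ Set.Icc 0 T, ∀ x, ∑ i, ‖FunctionSpaces.Torus.partialDeriv i (ψ t) x‖ ≤ C := by
  obtain ⟨Kp, hKp⟩ := (hψ.timeDeriv.isSmoothSpaceTimeOn Set.univ).exists_norm_le_of_isCompact
    isCompact_Icc (Set.subset_univ (Set.Icc 0 T))
  obtain ⟨KL, hKL⟩ := hψ.isSmoothSpaceTimeOn_laplacian.exists_norm_le_of_isCompact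
    isCompact_Icc (Set.subset_univ (Set.Icc 0 T))
  obtain ⟨Kq, hKq⟩ := (hψ.isSmoothSpaceTimeOn Set.univ).exists_norm_le_of_isCompact
    isCompact_Icc (Set.subset_univ (Set.Icc 0 T))
  choose Ci hCi using fun i : d => (hψ.isSmoothSpaceTimeOn_partialDeriv i).exists_norm_le_of_isCompact
    isCompact_Icc (Set.subset_univ (Set.Icc 0 T))
  refine ⟨Kp, KL, Kq, ∑ i, max (Ci i) 0, Finset.sum_nonneg fun i _ => le_max_right _ _, hKp, hKL, hKq,
    fun t ht x => Finset.sum_le_sum fun i _ => (hCi i t ht x).trans (le_max_left _ _)⟩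

end TestData

/-! ## Passage to the limit `n → ∞` in the weak-form functional -/

section Limit

variable {T : ℝ} {ψ : ℝ → UnitAddTorus d → EuclideanSpace ℝ d}

/-- **Continuity in time of weak-form slice functionals**, general test data: if `W`, `G` have
space–time lifts continuous on `[0, ∞) × ℝ^d`, the test data `p`, `b`, `L` have continuous lifts,
every `b t` is smooth and the lifts of `∂ᵢ(b t)` are continuous, then
`t ↦ ∫ (⟪W t, p t⟫ + ⟪W t, (W t·∇)(b t)⟫ + ν⟪W t, L t⟫ + ⟪G t, b t⟫)` is continuous on `[0, ∞)`. [folklore] -/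
theorem continuousOn_sliceFunctional_of {W G p b L : ℝ → UnitAddTorus d → EuclideanSpace ℝ d}
    (hW : ContinuousOn (FunctionSpaces.Torus.stLift W) (Set.Ici 0 ×ˢ Set.univ))
    (hG : ContinuousOn (FunctionSpaces.Torus.stLift G) (Set.Ici 0 ×ˢ Set.univ))
    (hp : Continuous (FunctionSpaces.Torus.stLift p)) (hq : Continuous (FunctionSpaces.Torus.stLift b)) (hL : Continuous (FunctionSpaces.Torus.stLift L))
    (hb : ∀ t, FunctionSpaces.Torus.IsSmooth (b t)) (hD : ∀ i, Continuous (FunctionSpaces.Torus.stLift fun t => FunctionSpaces.Torus.partialDeriv i (b t)))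
    (ν : ℝ) :
    ContinuousOn (fun t => ∫ x, (⟪W t x, p t x⟫ + ⟪W t x, FunctionSpaces.Torus.convect (W t) (b t) x⟫ +
      ν * ⟪W t x, L t x⟫ + ⟪G t x, b t x⟫)) (Set.Ici 0) := by
  refine FunctionSpaces.Torus.continuousOn_integral_of_continuousOn_stLift ?_
  have h : (FunctionSpaces.Torus.stLift fun t x => ⟪W t x, p t x⟫ + ⟪W t x, FunctionSpaces.Torus.convect (W t) (b t) x⟫ +
      ν * ⟪W t x, L t x⟫ + ⟪G t x, b t x⟫) = fun q => ⟪FunctionSpaces.Torus.stLift W q, FunctionSpaces.Torus.stLift p q⟫ +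
      ⟪FunctionSpaces.Torus.stLift W q, ∑ i, (FunctionSpaces.Torus.stLift W q) i • FunctionSpaces.Torus.stLift (fun t => FunctionSpaces.Torus.partialDeriv i (b t)) q⟫ +
      ν * ⟪FunctionSpaces.Torus.stLift W q, FunctionSpaces.Torus.stLift L q⟫ + ⟪FunctionSpaces.Torus.stLift G q, FunctionSpaces.Torus.stLift b q⟫ := by
    funext q
    obtain ⟨t, y⟩ := q
    simp only [FunctionSpaces.Torus.stLift_apply, FunctionSpaces.Torus.convect]
    rw [FunctionSpaces.Torus.fderiv_apply_eq_sum_partialDeriv ((hb t).isContDiff (by simp))]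
  rw [h]
  refine (((hW.inner hp.continuousOn).add (hW.inner (continuousOn_finsetSum _ fun i _ =>
    ((EuclideanSpace.proj (𝕜 := ℝ) i).continuous.comp_continuousOn hW).smul (hD i).continuousOn))).add
    ((hW.inner hL.continuousOn).const_smul ν |>.congr fun q _ => by simp)).add (hG.inner hq.continuousOn)

/-- **The weak-form slice functional of the approximations is continuous in time** on `[0, ∞)`
(all fields are jointly continuous). [folklore] -/
theorem IsHopfGalerkinScheme.continuousOn_sliceFunctional (hS : IsHopfGalerkinScheme ν f u₀ N F U)
    (hψ : FunctionSpaces.Torus.IsSpaceTimeTest T ψ) (n : ℕ) :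
    ContinuousOn (fun t => ∫ x, (⟪U n t x, FunctionSpaces.Torus.timeDeriv ψ t x⟫ +
      ⟪U n t x, FunctionSpaces.Torus.convect (U n t) (ψ t) x⟫ + ν * ⟪U n t x, FunctionSpaces.Torus.laplacian (ψ t) x⟫ +
      ⟪F n t x, ψ t x⟫)) (Set.Ici 0) :=
  continuousOn_sliceFunctional_of (hS.continuousOn n) (hS.continuousOn_force n) hψ.timeDeriv.1.continuous
    hψ.1.continuous hψ.isSmoothSpaceTimeOn_laplacian.continuous_stLift_of_univ hψ.isSmooth_slice
    (fun i => (hψ.isSmoothSpaceTimeOn_partialDeriv i).continuous_stLift_of_univ) ν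

/-- The weak-form slice functional of the limit is a.e. strongly measurable in time on `(0, T)`. [folklore] -/
theorem aestronglyMeasurable_sliceFunctional_limit (hψ : FunctionSpaces.Torus.IsSpaceTimeTest T ψ)
    (hfm : AEStronglyMeasurable (FunctionSpaces.Torus.stLift f) (volume.restrict (Set.Ioi 0 ×ˢ Set.univ)))
    (hum : AEStronglyMeasurable (FunctionSpaces.Torus.stLift u) (volume.restrict (Set.Ioi 0 ×ˢ Set.univ))) (ν : ℝ) :
    AEStronglyMeasurable (fun t => ∫ x, (⟪u t x, FunctionSpaces.Torus.timeDeriv ψ t x⟫ +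
      ⟪u t x, FunctionSpaces.Torus.convect (u t) (ψ t) x⟫ + ν * ⟪u t x, FunctionSpaces.Torus.laplacian (ψ t) x⟫ + ⟪f t x, ψ t x⟫))
      (volume.restrict (Set.Ioo 0 T)) := by
  have hu' := FunctionSpaces.Torus.aestronglyMeasurable_uncurry_prod_of_stLift hum T
  have hf' := FunctionSpaces.Torus.aestronglyMeasurable_uncurry_prod_of_stLift hfm T
  have hp : Continuous (uncurry (FunctionSpaces.Torus.timeDeriv ψ)) :=
    FunctionSpaces.Torus.continuous_uncurry_of_continuous_stLift hψ.timeDeriv.1.continuous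
  have hq : Continuous (uncurry ψ) := FunctionSpaces.Torus.continuous_uncurry_of_continuous_stLift hψ.1.continuous
  have hL : Continuous (uncurry fun t => FunctionSpaces.Torus.laplacian (ψ t)) :=
    FunctionSpaces.Torus.continuous_uncurry_of_continuous_stLift hψ.isSmoothSpaceTimeOn_laplacian.continuous_stLift_of_univ
  have hD : ∀ i, Continuous (uncurry fun t => FunctionSpaces.Torus.partialDeriv i (ψ t)) := fun i =>
    FunctionSpaces.Torus.continuous_uncurry_of_continuous_stLift
      (hψ.isSmoothSpaceTimeOn_partialDeriv i).continuous_stLift_of_univ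
  have h : AEStronglyMeasurable (fun q : ℝ × UnitAddTorus d => ⟪uncurry u q, uncurry (FunctionSpaces.Torus.timeDeriv ψ) q⟫ +
      ⟪uncurry u q, ∑ i, (uncurry u q) i • uncurry (fun t => FunctionSpaces.Torus.partialDeriv i (ψ t)) q⟫ +
      ν * ⟪uncurry u q, uncurry (fun t => FunctionSpaces.Torus.laplacian (ψ t)) q⟫ + ⟪uncurry f q, uncurry ψ q⟫)
      ((volume.restrict (Set.Ioo 0 T)).prod volume) := by
    exact (((hu'.inner hp.aestronglyMeasurable).add (hu'.inner (Finset.aestronglyMeasurable_fun_sum _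
      fun i _ => ((EuclideanSpace.proj (𝕜 := ℝ) i).continuous.comp_aestronglyMeasurable hu').smul
        (hD i).aestronglyMeasurable))).add ((hu'.inner hL.aestronglyMeasurable).const_mul ν)).add
      (hf'.inner hq.aestronglyMeasurable)
  have h2 := h.integral_prod_right'
  refine h2.congr (ae_of_all _ fun t => ?_)
  refine integral_congr_ae (ae_of_all _ fun x => ?_)
  simp only [uncurry_apply_pair, FunctionSpaces.Torus.convect]
  rw [FunctionSpaces.Torus.fderiv_apply_eq_sum_partialDeriv ((hψ.isSmooth_slice t).isContDiff (by simp))]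

/-- **`L¹(0,T)` convergence of the weak-form slice functionals** (Robinson–Rodrigo–Sadowski
2016, Thm. 4.4 Step 4, p. 77; Constantin–Foias 1988, p. 46): with `ψ` a fixed test field,
`∫₀ᵀ |Φ(U n, F n)(t) - Φ(u, f)(t)| dt → 0`, by the slice estimate
`Torus.enorm_sliceFunctional_sub_le` integrated in time (`U n → u`, `F n → f` in `L²ₜₓ`,
`U n`, `u` bounded in `L²ₜₓ`; choose `λ` small, then `n` large). [cite: RobinsonRodrigoSadowski2016, Thm. 4.4 Step 4] -/
theorem IsHopfGalerkinScheme.tendsto_lintegral_sliceFunctional_sub (hS : IsHopfGalerkinScheme ν f u₀ N F U)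
    (hν : 0 < ν) (hu₀ : MemLp u₀ 2 volume)
    (hfm : AEStronglyMeasurable (FunctionSpaces.Torus.stLift f) (volume.restrict (Set.Ioi 0 ×ˢ Set.univ)))
    (hf₂ : ∀ T, 0 < T → ∫⁻ t in Set.Ioo 0 T, ∫⁻ x, ‖f t x‖ₑ ^ 2 < ⊤)
    (hum : AEStronglyMeasurable (FunctionSpaces.Torus.stLift u) (volume.restrict (Set.Ioi 0 ×ˢ Set.univ)))
    (hu : ∀ t, 0 ≤ t → MemLp (u t) 2 volume)
    (hc : ∀ t, 0 ≤ t → ∀ k, Tendsto (fun n => mFourierCoeff (FunctionSpaces.EuclideanSpace.complexify ∘ U n t) k)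
      atTop (𝓝 (mFourierCoeff (FunctionSpaces.EuclideanSpace.complexify ∘ u t) k))) (hT : 0 < T)
    (hψ : FunctionSpaces.Torus.IsSpaceTimeTest T ψ) :
    Tendsto (fun n => ∫⁻ t in Set.Ioo 0 T, ‖(∫ x, (⟪U n t x, FunctionSpaces.Torus.timeDeriv ψ t x⟫ +
        ⟪U n t x, FunctionSpaces.Torus.convect (U n t) (ψ t) x⟫ + ν * ⟪U n t x, FunctionSpaces.Torus.laplacian (ψ t) x⟫ +
        ⟪F n t x, ψ t x⟫)) -
      ∫ x, (⟪u t x, FunctionSpaces.Torus.timeDeriv ψ t x⟫ + ⟪u t x, FunctionSpaces.Torus.convect (u t) (ψ t) x⟫ +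
        ν * ⟪u t x, FunctionSpaces.Torus.laplacian (ψ t) x⟫ + ⟪f t x, ψ t x⟫)‖ₑ) atTop (𝓝 0) := by
  obtain ⟨A, hA, hFA⟩ := hS.exists_force_bound hfm hf₂ hT
  obtain ⟨Y, hYdef⟩ : ∃ Y : ℝ, Y = 2 * (∫ x, ‖u₀ x‖ ^ 2) + 4 * T * A.toReal := ⟨_, rfl⟩
  have hYn : ∀ n, ∀ t ∈ Set.Icc 0 T, ∫ x, ‖U n t x‖ ^ 2 ≤ Y := fun n t ht =>
    (hS.integral_norm_sq_le hν.le hT hA n (hFA n) ht).trans (by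
      have := hS.integral_norm_sq_zero_le hu₀ n
      rw [hYdef]; linarith)
  have hYu : ∀ t ∈ Set.Icc 0 T, ∫ x, ‖u t x‖ ^ 2 ≤ Y := fun t ht => by
    rw [hYdef]; exact hS.integral_norm_sq_limit_le hν.le hu₀ hu hc hT hA hFA ht
  have hY0 : 0 ≤ Y := le_trans (integral_nonneg fun x => sq_nonneg _) (hYu 0 ⟨le_rfl, hT.le⟩)
  obtain ⟨Kp, KL, Kq, C, hC0, hKp, hKL, hKq, hC⟩ := hψ.exists_bounds
  -- the space–time quantities
  have hX : Tendsto (fun n => ∫⁻ τ in Set.Ioo 0 T, ∫⁻ x, ‖F n τ x - f τ x‖ₑ ^ 2) atTop (𝓝 0) :=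
    hS.tendsto_force T hT
  have hZ : Tendsto (fun n => ∫⁻ τ in Set.Ioo 0 T, ∫⁻ x, ‖U n τ x - u τ x‖ₑ ^ 2) atTop (𝓝 0) :=
    hS.tendsto_lintegral_enorm_sub_sq hν hu₀ hfm hf₂ hum hu hc hT
  have hBU : ∀ n, ∫⁻ τ in Set.Ioo 0 T, ∫⁻ x, ‖U n τ x‖ₑ ^ 2 ≤ ENNReal.ofReal (T * Y) := by
    intro n
    calc ∫⁻ τ in Set.Ioo 0 T, ∫⁻ x, ‖U n τ x‖ₑ ^ 2 ≤ ∫⁻ _ in Set.Ioo 0 T, ENNReal.ofReal Y := by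
          refine setLIntegral_mono' measurableSet_Ioo fun τ hτ => ?_
          rw [← ofReal_integral_norm_sq_slice (hS.continuousOn n) hτ.1.le]
          exact ENNReal.ofReal_le_ofReal (hYn n τ ⟨hτ.1.le, hτ.2.le⟩)
      _ = ENNReal.ofReal (T * Y) := by
          rw [setLIntegral_const, Real.volume_Ioo, sub_zero, ← ENNReal.ofReal_mul hY0, mul_comm]
  have hBu : ∫⁻ τ in Set.Ioo 0 T, ∫⁻ x, ‖u τ x‖ₑ ^ 2 ≤ ENNReal.ofReal (T * Y) := by
    calc ∫⁻ τ in Set.Ioo 0 T, ∫⁻ x, ‖u τ x‖ₑ ^ 2 ≤ ∫⁻ _ in Set.Ioo 0 T, ENNReal.ofReal Y := by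
          refine setLIntegral_mono' measurableSet_Ioo fun τ hτ => ?_
          rw [Torus.lintegral_enorm_sq_eq_ofReal (hu τ hτ.1.le)]
          exact ENNReal.ofReal_le_ofReal (hYu τ ⟨hτ.1.le, hτ.2.le⟩)
      _ = ENNReal.ofReal (T * Y) := by
          rw [setLIntegral_const, Real.volume_Ioo, sub_zero, ← ENNReal.ofReal_mul hY0, mul_comm]
  -- measurability in `τ`
  have hm1 : ∀ n, AEMeasurable (fun τ => ∫⁻ x, ‖F n τ x - f τ x‖ₑ ^ 2) (volume.restrict (Set.Ioo 0 T)) :=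
    fun n => Torus.aemeasurable_lintegral_enorm_sub_sq (hS.aestronglyMeasurable_stLift_force n) hfm T
  have hm2 : ∀ n, AEMeasurable (fun τ => ∫⁻ x, ‖U n τ x‖ₑ ^ 2) (volume.restrict (Set.Ioo 0 T)) :=
    fun n => Torus.aemeasurable_lintegral_enorm_sq (hS.aestronglyMeasurable_stLift n) T
  have hm3 : ∀ n, AEMeasurable (fun τ => ∫⁻ x, ‖U n τ x - u τ x‖ₑ ^ 2) (volume.restrict (Set.Ioo 0 T)) :=
    fun n => Torus.aemeasurable_lintegral_enorm_sub_sq (hS.aestronglyMeasurable_stLift n) hum T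
  have hm4 : AEMeasurable (fun τ => ∫⁻ x, ‖u τ x‖ₑ ^ 2) (volume.restrict (Set.Ioo 0 T)) :=
    Torus.aemeasurable_lintegral_enorm_sq hum T
  -- integrate the slice estimate
  set Kc : ℝ≥0∞ := ENNReal.ofReal (Kp ^ 2 + ν ^ 2 * KL ^ 2 + Kq ^ 2) with hKc
  have hint : ∀ {lam : ℝ}, 0 < lam → ∀ n,
      ∫⁻ t in Set.Ioo 0 T, ‖(∫ x, (⟪U n t x, FunctionSpaces.Torus.timeDeriv ψ t x⟫ +
          ⟪U n t x, FunctionSpaces.Torus.convect (U n t) (ψ t) x⟫ + ν * ⟪U n t x, FunctionSpaces.Torus.laplacian (ψ t) x⟫ +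
          ⟪F n t x, ψ t x⟫)) -
        ∫ x, (⟪u t x, FunctionSpaces.Torus.timeDeriv ψ t x⟫ + ⟪u t x, FunctionSpaces.Torus.convect (u t) (ψ t) x⟫ +
          ν * ⟪u t x, FunctionSpaces.Torus.laplacian (ψ t) x⟫ + ⟪f t x, ψ t x⟫)‖ₑ ≤
        ENNReal.ofReal (lam / 2) * (Kc * ENNReal.ofReal T + ENNReal.ofReal (C ^ 2) *
          (ENNReal.ofReal (T * Y) + ENNReal.ofReal (T * Y))) +
          ENNReal.ofReal (2 * lam)⁻¹ * (4 * (∫⁻ τ in Set.Ioo 0 T, ∫⁻ x, ‖U n τ x - u τ x‖ₑ ^ 2) +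
            ∫⁻ τ in Set.Ioo 0 T, ∫⁻ x, ‖F n τ x - f τ x‖ₑ ^ 2) := by
    intro lam hlam n
    have hpt : ∀ᵐ t ∂(volume.restrict (Set.Ioo 0 T)),
        ‖(∫ x, (⟪U n t x, FunctionSpaces.Torus.timeDeriv ψ t x⟫ +
            ⟪U n t x, FunctionSpaces.Torus.convect (U n t) (ψ t) x⟫ + ν * ⟪U n t x, FunctionSpaces.Torus.laplacian (ψ t) x⟫ +
            ⟪F n t x, ψ t x⟫)) -
          ∫ x, (⟪u t x, FunctionSpaces.Torus.timeDeriv ψ t x⟫ + ⟪u t x, FunctionSpaces.Torus.convect (u t) (ψ t) x⟫ +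
            ν * ⟪u t x, FunctionSpaces.Torus.laplacian (ψ t) x⟫ + ⟪f t x, ψ t x⟫)‖ₑ ≤
          ENNReal.ofReal (2 * lam)⁻¹ * (4 * (∫⁻ x, ‖U n t x - u t x‖ₑ ^ 2) + ∫⁻ x, ‖F n t x - f t x‖ₑ ^ 2) +
            ENNReal.ofReal (lam / 2) * (Kc + ENNReal.ofReal (C ^ 2) *
              ((∫⁻ x, ‖U n t x‖ₑ ^ 2) + ∫⁻ x, ‖u t x‖ₑ ^ 2)) := by
      filter_upwards [FunctionSpaces.Torus.ae_memLp_slice hfm (hf₂ T hT), ae_restrict_mem measurableSet_Ioo]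
        with t hft ht
      have ht' : t ∈ Set.Icc 0 T := ⟨ht.1.le, ht.2.le⟩
      have hFm : MemLp (F n t) 2 volume := (hS.continuous_force_slice n ht.1.le).memLp_of_hasCompactSupport
        (HasCompactSupport.of_compactSpace _)
      exact Torus.enorm_sliceFunctional_sub_le (hS.memLp_slice n ht.1.le) (hu t ht.1.le) hFm hft
        (hψ.isSmooth_slice t) (hψ.timeDeriv.isSmooth_slice t).continuous
        (hψ.isSmooth_slice t).laplacian.continuous (hC t ht') (hKp t ht') (hKL t ht') (hKq t ht') ν hlam
    refine (lintegral_mono_ae hpt).trans ?_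
    have mA : AEMeasurable (fun t => 4 * (∫⁻ x, ‖U n t x - u t x‖ₑ ^ 2) + ∫⁻ x, ‖F n t x - f t x‖ₑ ^ 2)
        (volume.restrict (Set.Ioo 0 T)) := ((hm3 n).const_mul _).add (hm1 n)
    have m24 : AEMeasurable (fun t => (∫⁻ x, ‖U n t x‖ₑ ^ 2) + ∫⁻ x, ‖u t x‖ₑ ^ 2)
        (volume.restrict (Set.Ioo 0 T)) := (hm2 n).add hm4
    have mB : AEMeasurable (fun t => Kc + ENNReal.ofReal (C ^ 2) *
        ((∫⁻ x, ‖U n t x‖ₑ ^ 2) + ∫⁻ x, ‖u t x‖ₑ ^ 2)) (volume.restrict (Set.Ioo 0 T)) :=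
      (m24.const_mul _).const_add _
    rw [lintegral_add_left' (mA.const_mul _), lintegral_const_mul'' _ mA, lintegral_const_mul'' _ mB,
      lintegral_add_left' ((hm3 n).const_mul _), lintegral_const_mul'' _ (hm3 n),
      lintegral_add_left' aemeasurable_const, lintegral_const_mul'' _ m24,
      lintegral_add_left' (hm2 n), setLIntegral_const, Real.volume_Ioo, sub_zero]
    rw [add_comm]
    have h1 := hBU n
    gcongr
  refine ENNReal.tendsto_zero_of_forall_le_ofReal_mul_add
    (C := Kc * ENNReal.ofReal T + ENNReal.ofReal (C ^ 2) * (ENNReal.ofReal (T * Y) + ENNReal.ofReal (T * Y)))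
    ?_ (X := fun lam n => ENNReal.ofReal (2 * (2 * lam))⁻¹ *
      (4 * (∫⁻ τ in Set.Ioo 0 T, ∫⁻ x, ‖U n τ x - u τ x‖ₑ ^ 2) +
        ∫⁻ τ in Set.Ioo 0 T, ∫⁻ x, ‖F n τ x - f τ x‖ₑ ^ 2)) (fun lam hlam => ?_) (fun lam hlam => ?_)
  · exact ENNReal.add_ne_top.2 ⟨ENNReal.mul_ne_top ENNReal.ofReal_ne_top ENNReal.ofReal_ne_top,
      ENNReal.mul_ne_top ENNReal.ofReal_ne_top (ENNReal.add_ne_top.2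
        ⟨ENNReal.ofReal_ne_top, ENNReal.ofReal_ne_top⟩)⟩
  · have h4 : Tendsto (fun n => (4 : ℝ≥0∞) * ∫⁻ τ in Set.Ioo 0 T, ∫⁻ x, ‖U n τ x - u τ x‖ₑ ^ 2) atTop
        (𝓝 ((4 : ℝ≥0∞) * 0)) :=
      ENNReal.Tendsto.const_mul hZ (Or.inr (by norm_num))
    have h := ENNReal.Tendsto.const_mul (h4.add hX) (a := ENNReal.ofReal (2 * (2 * lam))⁻¹)
      (Or.inr ENNReal.ofReal_ne_top)
    simpa using h
  · refine Eventually.of_forall fun n => ?_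
    have h := hint (lam := 2 * lam) (by positivity) n
    rwa [show 2 * lam / 2 = lam by ring] at h

/-- **The weak-form functionals converge**: `∫₀ᵀ Φ(U n, F n) → ∫₀ᵀ Φ(u, f)` for every test field
(`tendsto_integral_of_L1` on `(0, T)`). [cite: RobinsonRodrigoSadowski2016, Thm. 4.4 Step 4] -/
theorem IsHopfGalerkinScheme.tendsto_integral_sliceFunctional (hS : IsHopfGalerkinScheme ν f u₀ N F U)
    (hν : 0 < ν) (hu₀ : MemLp u₀ 2 volume)
    (hfm : AEStronglyMeasurable (FunctionSpaces.Torus.stLift f) (volume.restrict (Set.Ioi 0 ×ˢ Set.univ)))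
    (hf₂ : ∀ T, 0 < T → ∫⁻ t in Set.Ioo 0 T, ∫⁻ x, ‖f t x‖ₑ ^ 2 < ⊤)
    (hum : AEStronglyMeasurable (FunctionSpaces.Torus.stLift u) (volume.restrict (Set.Ioi 0 ×ˢ Set.univ)))
    (hu : ∀ t, 0 ≤ t → MemLp (u t) 2 volume)
    (hc : ∀ t, 0 ≤ t → ∀ k, Tendsto (fun n => mFourierCoeff (FunctionSpaces.EuclideanSpace.complexify ∘ U n t) k)
      atTop (𝓝 (mFourierCoeff (FunctionSpaces.EuclideanSpace.complexify ∘ u t) k))) (hT : 0 < T)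
    (hψ : FunctionSpaces.Torus.IsSpaceTimeTest T ψ) :
    Tendsto (fun n => ∫ t in Set.Ioo 0 T, ∫ x, (⟪U n t x, FunctionSpaces.Torus.timeDeriv ψ t x⟫ +
        ⟪U n t x, FunctionSpaces.Torus.convect (U n t) (ψ t) x⟫ + ν * ⟪U n t x, FunctionSpaces.Torus.laplacian (ψ t) x⟫ +
        ⟪F n t x, ψ t x⟫)) atTop
      (𝓝 (∫ t in Set.Ioo 0 T, ∫ x, (⟪u t x, FunctionSpaces.Torus.timeDeriv ψ t x⟫ +
        ⟪u t x, FunctionSpaces.Torus.convect (u t) (ψ t) x⟫ + ν * ⟪u t x, FunctionSpaces.Torus.laplacian (ψ t) x⟫ +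
        ⟪f t x, ψ t x⟫))) := by
  refine tendsto_integral_of_L1 (μ := volume.restrict (Set.Ioo 0 T)) _
    (aestronglyMeasurable_sliceFunctional_limit hψ hfm hum ν) (Eventually.of_forall fun n => ?_)
    (hS.tendsto_lintegral_sliceFunctional_sub hν hu₀ hfm hf₂ hum hu hc hT hψ)
  exact ((hS.continuousOn_sliceFunctional hψ n).mono Set.Icc_subset_Ici_self).integrableOn_Icc.mono_set
    Set.Ioo_subset_Icc_self

end Limit

/-! ## The truncation error `E_n(ψ) - E_n(P_{N n} ψ)` and the weak form of the limit -/

section WeakForm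

variable {T : ℝ} {ψ : ℝ → UnitAddTorus d → EuclideanSpace ℝ d}

omit [DecidableEq d] in
/-- Partial derivatives of a difference of smooth fields. [folklore] -/
theorem Torus.partialDeriv_sub_apply [DecidableEq d] {v w : UnitAddTorus d → EuclideanSpace ℝ d}
    (hv : FunctionSpaces.Torus.IsSmooth v) (hw : FunctionSpaces.Torus.IsSmooth w) (j : d) (x : UnitAddTorus d) :
    FunctionSpaces.Torus.partialDeriv j (fun y => v y - w y) x = FunctionSpaces.Torus.partialDeriv j v x - FunctionSpaces.Torus.partialDeriv j w x :=
  ((hv.hasDerivAt_line_zero j x).sub (hw.hasDerivAt_line_zero j x)).deriv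

/-- The convective derivative is linear in the test field: differences. [folklore] -/
theorem Torus.convect_sub_apply {v w : UnitAddTorus d → EuclideanSpace ℝ d}
    (hv : FunctionSpaces.Torus.IsSmooth v) (hw : FunctionSpaces.Torus.IsSmooth w) (u' : UnitAddTorus d → EuclideanSpace ℝ d)
    (x : UnitAddTorus d) :
    FunctionSpaces.Torus.convect u' (fun y => v y - w y) x = FunctionSpaces.Torus.convect u' v x - FunctionSpaces.Torus.convect u' w x := by
  unfold FunctionSpaces.Torus.convect
  have hvw : FunctionSpaces.Torus.IsSmooth (fun y => v y - w y) := hv.sub hw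
  rw [FunctionSpaces.Torus.fderiv_apply_eq_sum_partialDeriv (hvw.isContDiff (by simp)),
    FunctionSpaces.Torus.fderiv_apply_eq_sum_partialDeriv (hv.isContDiff (by simp)),
    FunctionSpaces.Torus.fderiv_apply_eq_sum_partialDeriv (hw.isContDiff (by simp)), ← Finset.sum_sub_distrib]
  refine Finset.sum_congr rfl fun i _ => ?_
  rw [← smul_sub]
  congr 1
  exact Torus.partialDeriv_sub_apply hv hw i x

/-- The Laplacian of a difference of smooth fields. [folklore] -/
theorem Torus.laplacian_sub_apply {v w : UnitAddTorus d → EuclideanSpace ℝ d}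
    (hv : FunctionSpaces.Torus.IsSmooth v) (hw : FunctionSpaces.Torus.IsSmooth w) (x : UnitAddTorus d) :
    FunctionSpaces.Torus.laplacian (fun y => v y - w y) x = FunctionSpaces.Torus.laplacian v x - FunctionSpaces.Torus.laplacian w x := by
  have hvw : FunctionSpaces.Torus.IsSmooth (fun y => v y - w y) := hv.sub hw
  rw [FunctionSpaces.Torus.laplacian_eq_sum_partialDeriv_partialDeriv hvw,
    FunctionSpaces.Torus.laplacian_eq_sum_partialDeriv_partialDeriv hv, FunctionSpaces.Torus.laplacian_eq_sum_partialDeriv_partialDeriv hw,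
    ← Finset.sum_sub_distrib]
  refine Finset.sum_congr rfl fun j _ => ?_
  have h1 : FunctionSpaces.Torus.partialDeriv j (fun y => v y - w y) = fun y => FunctionSpaces.Torus.partialDeriv j v y - FunctionSpaces.Torus.partialDeriv j w y :=
    funext fun y => Torus.partialDeriv_sub_apply hv hw j y
  rw [h1]
  exact Torus.partialDeriv_sub_apply (hv.partialDeriv j) (hw.partialDeriv j) j x

/-- The space–time lift of a slicewise Fourier truncation is continuous when the coefficients are
continuous in time. [folklore] -/
theorem Torus.continuous_stLift_fourierTruncate {b : ℝ → UnitAddTorus d → EuclideanSpace ℝ d}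
    (hb : ∀ k, Continuous fun t => mFourierCoeff (FunctionSpaces.EuclideanSpace.complexify ∘ b t) k) (M : ℕ) :
    Continuous (FunctionSpaces.Torus.stLift fun t x => FunctionSpaces.Torus.fourierTruncate M (b t) x) := by
  have h : (FunctionSpaces.Torus.stLift fun t x => FunctionSpaces.Torus.fourierTruncate M (b t) x) = fun q =>
      ∑ k ∈ FunctionSpaces.Torus.freqBall M, FunctionSpaces.EuclideanSpace.realPart
        (mFourier k (FunctionSpaces.Torus.proj q.2) • mFourierCoeff (FunctionSpaces.EuclideanSpace.complexify ∘ b q.1) k) := by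
    funext q
    obtain ⟨t, y⟩ := q
    rw [FunctionSpaces.Torus.stLift_apply, FunctionSpaces.Torus.fourierTruncate_eq, FunctionSpaces.Torus.realTrigPoly_apply_eq_sum]
  rw [h]
  refine continuous_finsetSum _ fun k _ => FunctionSpaces.EuclideanSpace.realPart.continuous.comp ?_
  exact (((mFourier k).continuous.comp (FunctionSpaces.Torus.continuous_proj.comp continuous_snd))).smul
    ((hb k).comp continuous_fst)

omit [Fintype d] [DecidableEq d] in
/-- Pointwise bound for the truncation error of the weak-form integrand: with
`‖dp‖ ≤ e₁`, `‖dL‖ ≤ e₂`, `‖dq‖ ≤ e₀`, `‖dc‖ ≤ ‖U‖ e₃` (all `eᵢ ≥ 0`),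
`|⟪U,dp⟫ + ⟪U,dc⟫ + ν⟪U,dL⟫ + ⟪F,dq⟫| ≤ (e₁/2 + |ν|e₂/2 + e₃)‖U‖² + (e₀/2)‖F‖² + (e₁/2 + |ν|e₂/2 + e₀/2)`
(`r e ≤ ((r² + 1)/2) e`). [folklore] -/
theorem abs_weakIntegrand_trunc_le {E : Type*} [NormedAddCommGroup E] [InnerProductSpace ℝ E]
    (U' F' dp dc dL dq : E) (ν : ℝ) {e₀ e₁ e₂ e₃ : ℝ} (he₀ : 0 ≤ e₀) (he₁ : 0 ≤ e₁) (he₂ : 0 ≤ e₂)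
    (hdp : ‖dp‖ ≤ e₁) (hdL : ‖dL‖ ≤ e₂) (hdq : ‖dq‖ ≤ e₀) (hdc : ‖dc‖ ≤ ‖U'‖ * e₃) :
    |⟪U', dp⟫ + ⟪U', dc⟫ + ν * ⟪U', dL⟫ + ⟪F', dq⟫| ≤
      (e₁ / 2 + |ν| * e₂ / 2 + e₃) * ‖U'‖ ^ 2 + e₀ / 2 * ‖F'‖ ^ 2 + (e₁ / 2 + |ν| * e₂ / 2 + e₀ / 2) := by
  have hU0 := norm_nonneg U'
  have hF0 := norm_nonneg F'
  have b1 : |⟪U', dp⟫| ≤ ‖U'‖ * e₁ := (abs_real_inner_le_norm _ _).trans (mul_le_mul_of_nonneg_left hdp hU0)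
  have b2 : |⟪U', dc⟫| ≤ ‖U'‖ ^ 2 * e₃ := by
    refine (abs_real_inner_le_norm _ _).trans ?_
    calc ‖U'‖ * ‖dc‖ ≤ ‖U'‖ * (‖U'‖ * e₃) := mul_le_mul_of_nonneg_left hdc hU0
      _ = ‖U'‖ ^ 2 * e₃ := by ring
  have b3 : |ν * ⟪U', dL⟫| ≤ |ν| * (‖U'‖ * e₂) := by
    rw [abs_mul]
    exact mul_le_mul_of_nonneg_left ((abs_real_inner_le_norm _ _).trans (mul_le_mul_of_nonneg_left hdL hU0))
      (abs_nonneg ν)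
  have b4 : |⟪F', dq⟫| ≤ ‖F'‖ * e₀ := (abs_real_inner_le_norm _ _).trans (mul_le_mul_of_nonneg_left hdq hF0)
  have hU1 : ‖U'‖ ≤ (‖U'‖ ^ 2 + 1) / 2 := by nlinarith [sq_nonneg (‖U'‖ - 1)]
  have hF1 : ‖F'‖ ≤ (‖F'‖ ^ 2 + 1) / 2 := by nlinarith [sq_nonneg (‖F'‖ - 1)]
  have a1 := mul_le_mul_of_nonneg_right hU1 he₁
  have a2 := mul_le_mul_of_nonneg_left (mul_le_mul_of_nonneg_right hU1 he₂) (abs_nonneg ν)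
  have a3 := mul_le_mul_of_nonneg_right hF1 he₀
  calc |⟪U', dp⟫ + ⟪U', dc⟫ + ν * ⟪U', dL⟫ + ⟪F', dq⟫|
      ≤ |⟪U', dp⟫| + |⟪U', dc⟫| + |ν * ⟪U', dL⟫| + |⟪F', dq⟫| :=
        (abs_add_le _ _).trans (add_le_add ((abs_add_le _ _).trans (add_le_add (abs_add_le _ _) le_rfl)) le_rfl)
    _ ≤ ‖U'‖ * e₁ + ‖U'‖ ^ 2 * e₃ + |ν| * (‖U'‖ * e₂) + ‖F'‖ * e₀ := by linarith
    _ ≤ (‖U'‖ ^ 2 + 1) / 2 * e₁ + ‖U'‖ ^ 2 * e₃ + |ν| * ((‖U'‖ ^ 2 + 1) / 2 * e₂) +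
          (‖F'‖ ^ 2 + 1) / 2 * e₀ := by linarith
    _ = _ := by ring

/-- The slices of the truncated test field `P_M ψ(t)` are smooth. [folklore] -/
theorem Torus.isSmooth_fourierTruncate_slice (ψ : ℝ → UnitAddTorus d → EuclideanSpace ℝ d)
    (M : ℕ) (t : ℝ) : FunctionSpaces.Torus.IsSmooth (fun y => FunctionSpaces.Torus.fourierTruncate M (ψ t) y) := by
  rw [show (fun y => FunctionSpaces.Torus.fourierTruncate M (ψ t) y) = FunctionSpaces.Torus.fourierTruncate M (ψ t) from rfl,
    FunctionSpaces.Torus.fourierTruncate_eq]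
  exact FunctionSpaces.Torus.isSmooth_realTrigPoly _ _

/-- **Slice bound for the truncation error of the weak-form functional**: for `t ∈ [0, T]`,
given the uniform truncation errors `e₀, e₁, e₂` of `ψ, ∂ₜψ, Δψ` and `e₃` of `∑ᵢ ‖∂ᵢψ - P_M ∂ᵢψ‖`
at time `t`,
`|Φₙ(ψ)(t) - Φₙ(P_M ψ)(t)| ≤ (e₁/2 + |ν|e₂/2 + e₃) ∫‖U n t‖² + (e₀/2) ∫‖F n t‖² + (e₁/2 + |ν|e₂/2 + e₀/2)`.
[cite: RobinsonRodrigoSadowski2016, Thm. 4.4 Step 4] -/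
theorem IsHopfGalerkinScheme.norm_sliceFunctional_trunc_sub_le (hS : IsHopfGalerkinScheme ν f u₀ N F U)
    (hψ : FunctionSpaces.Torus.IsSpaceTimeTest T ψ) (n M : ℕ) {t : ℝ} (ht0 : 0 ≤ t) {e₀ e₁ e₂ e₃ : ℝ}
    (he₀ : 0 ≤ e₀) (he₁ : 0 ≤ e₁) (he₂ : 0 ≤ e₂)
    (h₀ : ∀ x, ‖ψ t x - FunctionSpaces.Torus.fourierTruncate M (ψ t) x‖ ≤ e₀)
    (h₁ : ∀ x, ‖FunctionSpaces.Torus.timeDeriv ψ t x - FunctionSpaces.Torus.fourierTruncate M (FunctionSpaces.Torus.timeDeriv ψ t) x‖ ≤ e₁)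
    (h₂ : ∀ x, ‖FunctionSpaces.Torus.laplacian (ψ t) x - FunctionSpaces.Torus.fourierTruncate M (FunctionSpaces.Torus.laplacian (ψ t)) x‖ ≤ e₂)
    (h₃ : ∀ x, ∑ i, ‖FunctionSpaces.Torus.partialDeriv i (ψ t) x -
      FunctionSpaces.Torus.fourierTruncate M (FunctionSpaces.Torus.partialDeriv i (ψ t)) x‖ ≤ e₃) :
    ‖(∫ x, (⟪U n t x, FunctionSpaces.Torus.timeDeriv ψ t x⟫ +
        ⟪U n t x, FunctionSpaces.Torus.convect (U n t) (ψ t) x⟫ + ν * ⟪U n t x, FunctionSpaces.Torus.laplacian (ψ t) x⟫ +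
        ⟪F n t x, ψ t x⟫)) - ∫ x, (⟪U n t x, FunctionSpaces.Torus.fourierTruncate M (FunctionSpaces.Torus.timeDeriv ψ t) x⟫ +
        ⟪U n t x, FunctionSpaces.Torus.convect (U n t) (fun y => FunctionSpaces.Torus.fourierTruncate M (ψ t) y) x⟫ +
        ν * ⟪U n t x, FunctionSpaces.Torus.laplacian (fun y => FunctionSpaces.Torus.fourierTruncate M (ψ t) y) x⟫ +
        ⟪F n t x, FunctionSpaces.Torus.fourierTruncate M (ψ t) x⟫)‖ ≤
      (e₁ / 2 + |ν| * e₂ / 2 + e₃) * (∫ x, ‖U n t x‖ ^ 2) + e₀ / 2 * (∫ x, ‖F n t x‖ ^ 2) +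
        (e₁ / 2 + |ν| * e₂ / 2 + e₀ / 2) := by
  have hcU : Continuous (U n t) := hS.continuous_slice n ht0
  have hcF : Continuous (F n t) := hS.continuous_force_slice n ht0
  have hmU : MemLp (U n t) 2 volume := hS.memLp_slice n ht0
  have hmF : MemLp (F n t) 2 volume := hcF.memLp_of_hasCompactSupport (HasCompactSupport.of_compactSpace _)
  have hPs := Torus.isSmooth_fourierTruncate_slice ψ M t
  have hsl := hψ.isSmooth_slice t
  have i1 := Torus.integrable_weakIntegrand hmU hmF hsl (hψ.timeDeriv.isSmooth_slice t).continuous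
    hsl.laplacian.continuous ν
  have hPp : Continuous (fun x => FunctionSpaces.Torus.fourierTruncate M (FunctionSpaces.Torus.timeDeriv ψ t) x) := by
    rw [show (fun x => FunctionSpaces.Torus.fourierTruncate M (FunctionSpaces.Torus.timeDeriv ψ t) x) =
      FunctionSpaces.Torus.fourierTruncate M (FunctionSpaces.Torus.timeDeriv ψ t) from rfl, FunctionSpaces.Torus.fourierTruncate_eq]
    exact (FunctionSpaces.Torus.isSmooth_realTrigPoly _ _).continuous
  have i2 := Torus.integrable_weakIntegrand hmU hmF hPs hPp hPs.laplacian.continuous ν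
  rw [← integral_sub i1 i2]
  -- pointwise
  have hpt : ∀ x, ‖(⟪U n t x, FunctionSpaces.Torus.timeDeriv ψ t x⟫ +
      ⟪U n t x, FunctionSpaces.Torus.convect (U n t) (ψ t) x⟫ + ν * ⟪U n t x, FunctionSpaces.Torus.laplacian (ψ t) x⟫ +
      ⟪F n t x, ψ t x⟫) - (⟪U n t x, FunctionSpaces.Torus.fourierTruncate M (FunctionSpaces.Torus.timeDeriv ψ t) x⟫ +
      ⟪U n t x, FunctionSpaces.Torus.convect (U n t) (fun y => FunctionSpaces.Torus.fourierTruncate M (ψ t) y) x⟫ +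
      ν * ⟪U n t x, FunctionSpaces.Torus.laplacian (fun y => FunctionSpaces.Torus.fourierTruncate M (ψ t) y) x⟫ +
      ⟪F n t x, FunctionSpaces.Torus.fourierTruncate M (ψ t) x⟫)‖ ≤
      (e₁ / 2 + |ν| * e₂ / 2 + e₃) * ‖U n t x‖ ^ 2 + e₀ / 2 * ‖F n t x‖ ^ 2 +
        (e₁ / 2 + |ν| * e₂ / 2 + e₀ / 2) := by
    intro x
    have hd : (⟪U n t x, FunctionSpaces.Torus.timeDeriv ψ t x⟫ +
        ⟪U n t x, FunctionSpaces.Torus.convect (U n t) (ψ t) x⟫ + ν * ⟪U n t x, FunctionSpaces.Torus.laplacian (ψ t) x⟫ +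
        ⟪F n t x, ψ t x⟫) - (⟪U n t x, FunctionSpaces.Torus.fourierTruncate M (FunctionSpaces.Torus.timeDeriv ψ t) x⟫ +
        ⟪U n t x, FunctionSpaces.Torus.convect (U n t) (fun y => FunctionSpaces.Torus.fourierTruncate M (ψ t) y) x⟫ +
        ν * ⟪U n t x, FunctionSpaces.Torus.laplacian (fun y => FunctionSpaces.Torus.fourierTruncate M (ψ t) y) x⟫ +
        ⟪F n t x, FunctionSpaces.Torus.fourierTruncate M (ψ t) x⟫) =
        ⟪U n t x, FunctionSpaces.Torus.timeDeriv ψ t x - FunctionSpaces.Torus.fourierTruncate M (FunctionSpaces.Torus.timeDeriv ψ t) x⟫ +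
        ⟪U n t x, FunctionSpaces.Torus.convect (U n t) (fun y => ψ t y - FunctionSpaces.Torus.fourierTruncate M (ψ t) y) x⟫ +
        ν * ⟪U n t x, FunctionSpaces.Torus.laplacian (ψ t) x - FunctionSpaces.Torus.fourierTruncate M (FunctionSpaces.Torus.laplacian (ψ t)) x⟫ +
        ⟪F n t x, ψ t x - FunctionSpaces.Torus.fourierTruncate M (ψ t) x⟫ := by
      rw [Torus.convect_sub_apply hsl hPs, FunctionSpaces.Torus.laplacian_fourierTruncate hsl]
      simp only [inner_sub_right]
      ring
    rw [hd, Real.norm_eq_abs]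
    refine abs_weakIntegrand_trunc_le _ _ _ _ _ _ ν he₀ he₁ he₂ (h₁ x) (h₂ x) (h₀ x) ?_
    have e3 : ∑ i, ‖FunctionSpaces.Torus.partialDeriv i (fun y => ψ t y - FunctionSpaces.Torus.fourierTruncate M (ψ t) y) x‖ ≤ e₃ := by
      refine le_trans (le_of_eq (Finset.sum_congr rfl fun i _ => ?_)) (h₃ x)
      rw [Torus.partialDeriv_sub_apply hsl hPs, FunctionSpaces.Torus.partialDeriv_fourierTruncate hsl]
    exact (FunctionSpaces.Torus.norm_convect_le (U n t) ((hsl.sub hPs).isContDiff (by simp)) x).trans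
      (mul_le_mul_of_nonneg_left e3 (norm_nonneg _))
  -- integrate
  have iU : Integrable (fun x => ‖U n t x‖ ^ 2) volume := (hcU.norm.pow 2).integrable_unitAddTorus
  have iF : Integrable (fun x => ‖F n t x‖ ^ 2) volume := (hcF.norm.pow 2).integrable_unitAddTorus
  have i12 : Integrable (fun x => (e₁ / 2 + |ν| * e₂ / 2 + e₃) * ‖U n t x‖ ^ 2 + e₀ / 2 * ‖F n t x‖ ^ 2)
      volume := (iU.const_mul _).add (iF.const_mul _)
  have i123 : Integrable (fun x => (e₁ / 2 + |ν| * e₂ / 2 + e₃) * ‖U n t x‖ ^ 2 + e₀ / 2 * ‖F n t x‖ ^ 2 +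
      (e₁ / 2 + |ν| * e₂ / 2 + e₀ / 2)) volume := i12.add (integrable_const _)
  refine (norm_integral_le_of_norm_le i123 (ae_of_all _ hpt)).trans (le_of_eq ?_)
  rw [integral_add i12 (integrable_const _), integral_add (iU.const_mul _) (iF.const_mul _),
    integral_const_mul, integral_const_mul, integral_const]
  simp [Measure.real]

/-- **The weak-form functional of the approximations tends to zero** (Robinson–Rodrigo–Sadowski
2016, Thm. 4.4 Step 4, p. 77: `P_n ψ → ψ` in `C¹`, so the Galerkin identity tested against `P_n ψ`
differs from the one tested against `ψ` by `o(1)` times the uniform bounds): with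
`E_n(ψ) = ∫₀ᵀ Φ(U n, F n) + ∫ ⟪u₀, ψ(0)⟫`, `E_n(ψ) → 0`, because
`E_n(P_{N n} ψ) = 0` (`galerkin_weak_identity`) and
`|E_n(ψ) - E_n(P_{N n}ψ)| ≤ τ_{N n} · const` with the lattice tail `τ_M → 0`
(`Torus.exists_norm_sub_fourierTruncate_le_spaceTime`). [cite: RobinsonRodrigoSadowski2016, Thm. 4.4 Step 4] -/
theorem IsHopfGalerkinScheme.tendsto_weakFunctional (hS : IsHopfGalerkinScheme ν f u₀ N F U)
    (hν : 0 ≤ ν) (hu₀ : MemLp u₀ 2 volume)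
    (hfm : AEStronglyMeasurable (FunctionSpaces.Torus.stLift f) (volume.restrict (Set.Ioi 0 ×ˢ Set.univ)))
    (hf₂ : ∀ T, 0 < T → ∫⁻ t in Set.Ioo 0 T, ∫⁻ x, ‖f t x‖ₑ ^ 2 < ⊤) (hT : 0 < T)
    (hψ : FunctionSpaces.Torus.IsSpaceTimeTest T ψ) (hdiv : FunctionSpaces.Torus.IsDivFreeTest ψ) :
    Tendsto (fun n => (∫ t in Set.Ioo 0 T, ∫ x, (⟪U n t x, FunctionSpaces.Torus.timeDeriv ψ t x⟫ +
        ⟪U n t x, FunctionSpaces.Torus.convect (U n t) (ψ t) x⟫ + ν * ⟪U n t x, FunctionSpaces.Torus.laplacian (ψ t) x⟫ +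
        ⟪F n t x, ψ t x⟫)) + ∫ x, ⟪u₀ x, ψ 0 x⟫) atTop (𝓝 0) := by
  obtain ⟨A, hA, hFA⟩ := hS.exists_force_bound hfm hf₂ hT
  obtain ⟨Y, hYdef⟩ : ∃ Y : ℝ, Y = 2 * (∫ x, ‖u₀ x‖ ^ 2) + 4 * T * A.toReal := ⟨_, rfl⟩
  have hYn : ∀ n, ∀ t ∈ Set.Icc 0 T, ∫ x, ‖U n t x‖ ^ 2 ≤ Y := fun n t ht =>
    (hS.integral_norm_sq_le hν hT hA n (hFA n) ht).trans (by
      have := hS.integral_norm_sq_zero_le hu₀ n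
      rw [hYdef]; linarith)
  have hY0 : 0 ≤ Y := le_trans (integral_nonneg fun x => sq_nonneg _) (hYn 0 0 ⟨le_rfl, hT.le⟩)
  -- uniform truncation errors of the test data
  obtain ⟨K₀, hK₀0, hK₀⟩ := FunctionSpaces.Torus.exists_norm_sub_fourierTruncate_le_spaceTime (hψ.isSmoothSpaceTimeOn Set.univ) T
  obtain ⟨K₁, hK₁0, hK₁⟩ := FunctionSpaces.Torus.exists_norm_sub_fourierTruncate_le_spaceTime
    (hψ.timeDeriv.isSmoothSpaceTimeOn Set.univ) T
  obtain ⟨K₂, hK₂0, hK₂⟩ := FunctionSpaces.Torus.exists_norm_sub_fourierTruncate_le_spaceTime hψ.isSmoothSpaceTimeOn_laplacian T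
  choose K₃ hK₃0 hK₃ using fun i => FunctionSpaces.Torus.exists_norm_sub_fourierTruncate_le_spaceTime
    (hψ.isSmoothSpaceTimeOn_partialDeriv i) T
  obtain ⟨τ, hτdef⟩ : ∃ τ : ℕ → ℝ, τ = fun M => ∑' k : {k // k ∉ FunctionSpaces.Torus.freqBall (d := d) M},
    ((1 + FunctionSpaces.Torus.freqNormSq (k : d → ℤ)) ^ Fintype.card d)⁻¹ := ⟨_, rfl⟩
  have hτ0 : ∀ M, 0 ≤ τ M := fun M => by
    rw [hτdef]
    exact tsum_nonneg fun k => inv_nonneg.2 (pow_nonneg (by linarith [FunctionSpaces.Torus.freqNormSq_nonneg (k : d → ℤ)]) _)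
  have hτlim : Tendsto (fun n => τ (N n)) atTop (𝓝 0) := by
    rw [hτdef]
    exact FunctionSpaces.Torus.tendsto_tsum_compl_freqBall_inv_pow.comp hS.tendsto_order
  obtain ⟨K3, hK3def⟩ : ∃ K3 : ℝ, K3 = ∑ i, K₃ i := ⟨_, rfl⟩
  have hK30 : 0 ≤ K3 := by rw [hK3def]; exact Finset.sum_nonneg fun i _ => hK₃0 i
  obtain ⟨a, hadef⟩ : ∃ a : ℝ, a = (K₁ + |ν| * K₂) / 2 + K3 := ⟨_, rfl⟩
  obtain ⟨c, hcdef⟩ : ∃ c : ℝ, c = (K₁ + |ν| * K₂) / 2 + K₀ / 2 := ⟨_, rfl⟩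
  have ha0 : 0 ≤ a := by rw [hadef]; positivity
  have hc0 : 0 ≤ c := by rw [hcdef]; positivity
  obtain ⟨Mc, hMcdef⟩ : ∃ Mc : ℝ, Mc = a * (T * Y) + K₀ / 2 * A.toReal + c * T + K₀ * ∫ x, ‖u₀ x‖ := ⟨_, rfl⟩
  -- coefficient continuity for the truncated tests
  have hcoef : ∀ (b : ℝ → UnitAddTorus d → EuclideanSpace ℝ d), FunctionSpaces.Torus.IsSmoothSpaceTimeOn Set.univ b →
      ∀ k, Continuous fun t => mFourierCoeff (FunctionSpaces.EuclideanSpace.complexify ∘ b t) k := by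
    intro b hb k
    rw [← continuousOn_univ]
    exact FunctionSpaces.Torus.continuousOn_mFourierCoeff_of_continuousOn_stLift hb.continuousOn_stLift k
  have hbound : ∀ n, |(∫ t in Set.Ioo 0 T, ∫ x, (⟪U n t x, FunctionSpaces.Torus.timeDeriv ψ t x⟫ +
      ⟪U n t x, FunctionSpaces.Torus.convect (U n t) (ψ t) x⟫ + ν * ⟪U n t x, FunctionSpaces.Torus.laplacian (ψ t) x⟫ +
      ⟪F n t x, ψ t x⟫)) + ∫ x, ⟪u₀ x, ψ 0 x⟫| ≤ τ (N n) * Mc := by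
    intro n
    -- the Galerkin identity against `P_(N n) ψ`, set-integral form
    have hGW := hS.galerkin_weak_identity hu₀ n hT hψ hdiv
    rw [intervalIntegral.integral_of_le hT.le, integral_Ioc_eq_integral_Ioo] at hGW
    -- continuity of the two slice functionals on `[0, T]`
    have hΦ : ContinuousOn _ (Set.Icc 0 T) := (hS.continuousOn_sliceFunctional hψ n).mono Set.Icc_subset_Ici_self
    have hPcont : Continuous (FunctionSpaces.Torus.stLift fun t x => FunctionSpaces.Torus.fourierTruncate (N n) (ψ t) x) :=
      Torus.continuous_stLift_fourierTruncate (hcoef ψ (hψ.isSmoothSpaceTimeOn Set.univ)) _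
    have hPp : Continuous (FunctionSpaces.Torus.stLift fun t x => FunctionSpaces.Torus.fourierTruncate (N n) (FunctionSpaces.Torus.timeDeriv ψ t) x) :=
      Torus.continuous_stLift_fourierTruncate (hcoef _ (hψ.timeDeriv.isSmoothSpaceTimeOn Set.univ)) _
    have hPL : Continuous (FunctionSpaces.Torus.stLift fun t x =>
        FunctionSpaces.Torus.laplacian (fun y => FunctionSpaces.Torus.fourierTruncate (N n) (ψ t) y) x) := by
      have h : (fun t x => FunctionSpaces.Torus.laplacian (fun y => FunctionSpaces.Torus.fourierTruncate (N n) (ψ t) y) x) =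
          fun t x => FunctionSpaces.Torus.fourierTruncate (N n) (FunctionSpaces.Torus.laplacian (ψ t)) x := by
        funext t x; exact FunctionSpaces.Torus.laplacian_fourierTruncate (hψ.isSmooth_slice t) _ x
      rw [h]
      exact Torus.continuous_stLift_fourierTruncate (hcoef _ hψ.isSmoothSpaceTimeOn_laplacian) _
    have hPD : ∀ i, Continuous (FunctionSpaces.Torus.stLift fun t =>
        FunctionSpaces.Torus.partialDeriv i (fun y => FunctionSpaces.Torus.fourierTruncate (N n) (ψ t) y)) := by
      intro i
      have h : (fun t => FunctionSpaces.Torus.partialDeriv i (fun y => FunctionSpaces.Torus.fourierTruncate (N n) (ψ t) y)) =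
          fun t x => FunctionSpaces.Torus.fourierTruncate (N n) (FunctionSpaces.Torus.partialDeriv i (ψ t)) x := by
        funext t x; exact FunctionSpaces.Torus.partialDeriv_fourierTruncate (hψ.isSmooth_slice t) _ i x
      rw [h]
      exact Torus.continuous_stLift_fourierTruncate (hcoef _ (hψ.isSmoothSpaceTimeOn_partialDeriv i)) _
    have hΦP : ContinuousOn _ (Set.Icc 0 T) := (continuousOn_sliceFunctional_of (hS.continuousOn n)
      (hS.continuousOn_force n) hPp hPcont hPL (Torus.isSmooth_fourierTruncate_slice ψ (N n)) hPD ν).mono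
      Set.Icc_subset_Ici_self
    have iΦ := (hΦ.integrableOn_Icc (μ := volume)).mono_set Set.Ioo_subset_Icc_self
    have iΦP := (hΦP.integrableOn_Icc (μ := volume)).mono_set Set.Ioo_subset_Icc_self
    -- `E_n = ∫ (Φ - Φ^P) + ∫ ⟪u₀, ψ 0 - P ψ 0⟫`
    have i0 : Integrable (fun x => ⟪u₀ x, ψ 0 x⟫) volume :=
      FunctionSpaces.Torus.integrable_inner_of_continuous (hu₀.integrable one_le_two) (hψ.isSmooth_slice 0).continuous
    have i0P : Integrable (fun x => ⟪u₀ x, FunctionSpaces.Torus.fourierTruncate (N n) (ψ 0) x⟫) volume :=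
      FunctionSpaces.Torus.integrable_inner_of_continuous (hu₀.integrable one_le_two)
        (Torus.isSmooth_fourierTruncate_slice ψ (N n) 0).continuous
    have hsplit : (∫ t in Set.Ioo 0 T, ∫ x, (⟪U n t x, FunctionSpaces.Torus.timeDeriv ψ t x⟫ +
        ⟪U n t x, FunctionSpaces.Torus.convect (U n t) (ψ t) x⟫ + ν * ⟪U n t x, FunctionSpaces.Torus.laplacian (ψ t) x⟫ +
        ⟪F n t x, ψ t x⟫)) + ∫ x, ⟪u₀ x, ψ 0 x⟫ =
        (∫ t in Set.Ioo 0 T, ((∫ x, (⟪U n t x, FunctionSpaces.Torus.timeDeriv ψ t x⟫ +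
          ⟪U n t x, FunctionSpaces.Torus.convect (U n t) (ψ t) x⟫ + ν * ⟪U n t x, FunctionSpaces.Torus.laplacian (ψ t) x⟫ +
          ⟪F n t x, ψ t x⟫)) - ∫ x, (⟪U n t x, FunctionSpaces.Torus.fourierTruncate (N n) (FunctionSpaces.Torus.timeDeriv ψ t) x⟫ +
          ⟪U n t x, FunctionSpaces.Torus.convect (U n t) (fun y => FunctionSpaces.Torus.fourierTruncate (N n) (ψ t) y) x⟫ +
          ν * ⟪U n t x, FunctionSpaces.Torus.laplacian (fun y => FunctionSpaces.Torus.fourierTruncate (N n) (ψ t) y) x⟫ +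
          ⟪F n t x, FunctionSpaces.Torus.fourierTruncate (N n) (ψ t) x⟫))) +
        ∫ x, ⟪u₀ x, ψ 0 x - FunctionSpaces.Torus.fourierTruncate (N n) (ψ 0) x⟫ := by
      rw [integral_sub iΦ iΦP]
      simp_rw [inner_sub_right]
      rw [integral_sub i0 i0P]
      linarith
    rw [hsplit]
    -- time integration of the slice bound
    have hE : ContinuousOn (fun t => ∫ x, ‖U n t x‖ ^ 2) (Set.Icc 0 T) :=
      (FunctionSpaces.Torus.continuousOn_integral_norm_sq_of_continuousOn_stLift (hS.continuousOn n)).mono Set.Icc_subset_Ici_self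
    have hG : ContinuousOn (fun t => ∫ x, ‖F n t x‖ ^ 2) (Set.Icc 0 T) :=
      (FunctionSpaces.Torus.continuousOn_integral_norm_sq_of_continuousOn_stLift (hS.continuousOn_force n)).mono
        Set.Icc_subset_Ici_self
    have iE := (hE.integrableOn_Icc (μ := volume)).mono_set Set.Ioo_subset_Icc_self
    have iG := (hG.integrableOn_Icc (μ := volume)).mono_set Set.Ioo_subset_Icc_self
    have hEb : ∫ t in Set.Ioo 0 T, ∫ x, ‖U n t x‖ ^ 2 ≤ T * Y := by
      have h := setIntegral_mono_on iE (integrableOn_const (C := Y) measure_Ioo_lt_top.ne) measurableSet_Ioo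
        fun t ht => hYn n t ⟨ht.1.le, ht.2.le⟩
      rwa [setIntegral_const, Real.volume_real_Ioo_of_le hT.le, sub_zero, smul_eq_mul] at h
    have hGb : ∫ t in Set.Ioo 0 T, ∫ x, ‖F n t x‖ ^ 2 ≤ A.toReal := by
      obtain ⟨-, heq⟩ := intervalIntegral_norm_sq_eq_toReal (hS.continuousOn_force n) le_rfl hT.le
      rw [intervalIntegral.integral_of_le hT.le, integral_Ioc_eq_integral_Ioo] at heq
      rw [heq]
      exact ENNReal.toReal_mono hA (hFA n)
    have hslice : ∀ t ∈ Set.Ioo 0 T, ‖(∫ x, (⟪U n t x, FunctionSpaces.Torus.timeDeriv ψ t x⟫ +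
        ⟪U n t x, FunctionSpaces.Torus.convect (U n t) (ψ t) x⟫ + ν * ⟪U n t x, FunctionSpaces.Torus.laplacian (ψ t) x⟫ +
        ⟪F n t x, ψ t x⟫)) - ∫ x, (⟪U n t x, FunctionSpaces.Torus.fourierTruncate (N n) (FunctionSpaces.Torus.timeDeriv ψ t) x⟫ +
        ⟪U n t x, FunctionSpaces.Torus.convect (U n t) (fun y => FunctionSpaces.Torus.fourierTruncate (N n) (ψ t) y) x⟫ +
        ν * ⟪U n t x, FunctionSpaces.Torus.laplacian (fun y => FunctionSpaces.Torus.fourierTruncate (N n) (ψ t) y) x⟫ +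
        ⟪F n t x, FunctionSpaces.Torus.fourierTruncate (N n) (ψ t) x⟫)‖ ≤
        τ (N n) * (a * (∫ x, ‖U n t x‖ ^ 2) + K₀ / 2 * (∫ x, ‖F n t x‖ ^ 2) + c) := by
      intro t ht
      have ht' : t ∈ Set.Icc 0 T := ⟨ht.1.le, ht.2.le⟩
      have hτn := hτ0 (N n)
      have h := hS.norm_sliceFunctional_trunc_sub_le hψ n (N n) ht.1.le
        (e₀ := K₀ * τ (N n)) (e₁ := K₁ * τ (N n)) (e₂ := K₂ * τ (N n)) (e₃ := K3 * τ (N n))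
        (mul_nonneg hK₀0 hτn) (mul_nonneg hK₁0 hτn) (mul_nonneg hK₂0 hτn)
        (fun x => by rw [hτdef]; exact hK₀ _ t ht' x) (fun x => by rw [hτdef]; exact hK₁ _ t ht' x)
        (fun x => by rw [hτdef]; exact hK₂ _ t ht' x)
        (fun x => by
          rw [hK3def, Finset.sum_mul]
          exact Finset.sum_le_sum fun i _ => by rw [hτdef]; exact hK₃ i _ t ht' x)
      refine h.trans (le_of_eq ?_)
      rw [hadef, hcdef]
      ring
    have ibound : IntegrableOn (fun t => τ (N n) * (a * (∫ x, ‖U n t x‖ ^ 2) + K₀ / 2 * (∫ x, ‖F n t x‖ ^ 2) + c))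
        (Set.Ioo 0 T) volume :=
      (((iE.const_mul _).add (iG.const_mul _)).add (integrableOn_const measure_Ioo_lt_top.ne)).const_mul _
    have h1 : ‖∫ t in Set.Ioo 0 T, ((∫ x, (⟪U n t x, FunctionSpaces.Torus.timeDeriv ψ t x⟫ +
        ⟪U n t x, FunctionSpaces.Torus.convect (U n t) (ψ t) x⟫ + ν * ⟪U n t x, FunctionSpaces.Torus.laplacian (ψ t) x⟫ +
        ⟪F n t x, ψ t x⟫)) - ∫ x, (⟪U n t x, FunctionSpaces.Torus.fourierTruncate (N n) (FunctionSpaces.Torus.timeDeriv ψ t) x⟫ +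
        ⟪U n t x, FunctionSpaces.Torus.convect (U n t) (fun y => FunctionSpaces.Torus.fourierTruncate (N n) (ψ t) y) x⟫ +
        ν * ⟪U n t x, FunctionSpaces.Torus.laplacian (fun y => FunctionSpaces.Torus.fourierTruncate (N n) (ψ t) y) x⟫ +
        ⟪F n t x, FunctionSpaces.Torus.fourierTruncate (N n) (ψ t) x⟫))‖ ≤
        τ (N n) * (a * (T * Y) + K₀ / 2 * A.toReal + c * T) := by
      refine (norm_integral_le_of_norm_le ibound ((ae_restrict_mem measurableSet_Ioo).mono hslice)).trans ?_
      have i12 : IntegrableOn (fun t => a * (∫ x, ‖U n t x‖ ^ 2) + K₀ / 2 * (∫ x, ‖F n t x‖ ^ 2))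
          (Set.Ioo 0 T) volume := (iE.const_mul _).add (iG.const_mul _)
      rw [integral_const_mul, integral_add i12 (integrableOn_const measure_Ioo_lt_top.ne),
        integral_add (iE.const_mul _) (iG.const_mul _), integral_const_mul, integral_const_mul,
        setIntegral_const, Real.volume_real_Ioo_of_le hT.le, sub_zero, smul_eq_mul]
      refine mul_le_mul_of_nonneg_left ?_ (hτ0 _)
      have a1 := mul_le_mul_of_nonneg_left hEb ha0
      have a2 := mul_le_mul_of_nonneg_left hGb (show 0 ≤ K₀ / 2 by positivity)
      linarith
    have h2 : ‖∫ x, ⟪u₀ x, ψ 0 x - FunctionSpaces.Torus.fourierTruncate (N n) (ψ 0) x⟫‖ ≤ τ (N n) * (K₀ * ∫ x, ‖u₀ x‖) := by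
      have ig : Integrable (fun x => ‖u₀ x‖ * (K₀ * τ (N n))) volume :=
        (hu₀.integrable one_le_two).norm.mul_const _
      refine (norm_integral_le_of_norm_le ig (ae_of_all _ fun x => ?_)).trans (le_of_eq ?_)
      · rw [Real.norm_eq_abs]
        refine (abs_real_inner_le_norm _ _).trans (mul_le_mul_of_nonneg_left ?_ (norm_nonneg _))
        rw [hτdef]; exact hK₀ _ 0 ⟨le_rfl, hT.le⟩ x
      · rw [integral_mul_const]; ring
    rw [← Real.norm_eq_abs]
    refine (norm_add_le _ _).trans ?_
    rw [hMcdef]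
    nlinarith [h1, h2, hτ0 (N n)]
  -- conclusion: squeeze
  have hMc0 : Tendsto (fun n => τ (N n) * Mc) atTop (𝓝 0) := by
    simpa using hτlim.mul_const Mc
  exact squeeze_zero_norm (fun n => by rw [Real.norm_eq_abs]; exact hbound n) hMc0

/-- **The weak form of the Navier–Stokes equations for the limit** (the fourth conjunct of
`Torus.IsWeakNSSolutionForcedOn`; Robinson–Rodrigo–Sadowski 2016, Thm. 4.4 Step 4, pp. 76–77;
Constantin–Foias 1988, Ch. 8, Theorem (Leray); Hopf 1951, §4): for every divergence-free
space–time test field `ψ` on `[0, T)`,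
`∫₀ᵀ ∫ (⟪u, ∂ₜψ⟫ + ⟪u, (u·∇)ψ⟫ + ν⟪u, Δψ⟫ + ⟪f, ψ⟫) + ∫ ⟪u₀, ψ(0)⟫ = 0`
(`E_n(ψ) → E(ψ)` by `tendsto_integral_sliceFunctional` and `E_n(ψ) → 0` by
`tendsto_weakFunctional`). [cite: RobinsonRodrigoSadowski2016, Thm. 4.4 Step 4] -/
theorem IsHopfGalerkinScheme.weak_form_limit (hS : IsHopfGalerkinScheme ν f u₀ N F U)
    (hν : 0 < ν) (hu₀ : MemLp u₀ 2 volume)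
    (hfm : AEStronglyMeasurable (FunctionSpaces.Torus.stLift f) (volume.restrict (Set.Ioi 0 ×ˢ Set.univ)))
    (hf₂ : ∀ T, 0 < T → ∫⁻ t in Set.Ioo 0 T, ∫⁻ x, ‖f t x‖ₑ ^ 2 < ⊤)
    (hum : AEStronglyMeasurable (FunctionSpaces.Torus.stLift u) (volume.restrict (Set.Ioi 0 ×ˢ Set.univ)))
    (hu : ∀ t, 0 ≤ t → MemLp (u t) 2 volume)
    (hc : ∀ t, 0 ≤ t → ∀ k, Tendsto (fun n => mFourierCoeff (FunctionSpaces.EuclideanSpace.complexify ∘ U n t) k)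
      atTop (𝓝 (mFourierCoeff (FunctionSpaces.EuclideanSpace.complexify ∘ u t) k))) (hT : 0 < T)
    (hψ : FunctionSpaces.Torus.IsSpaceTimeTest T ψ) (hdiv : FunctionSpaces.Torus.IsDivFreeTest ψ) :
    (∫ t in Set.Ioo 0 T, ∫ x, (⟪u t x, FunctionSpaces.Torus.timeDeriv ψ t x⟫ + ⟪u t x, FunctionSpaces.Torus.convect (u t) (ψ t) x⟫ +
        ν * ⟪u t x, FunctionSpaces.Torus.laplacian (ψ t) x⟫ + ⟪f t x, ψ t x⟫)) + ∫ x, ⟪u₀ x, ψ 0 x⟫ = 0 := by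
  have h1 := (hS.tendsto_integral_sliceFunctional hν hu₀ hfm hf₂ hum hu hc hT hψ).add_const
    (∫ x, ⟪u₀ x, ψ 0 x⟫)
  have h2 := hS.tendsto_weakFunctional hν.le hu₀ hfm hf₂ hT hψ hdiv
  exact tendsto_nhds_unique h1 h2

end WeakForm





end NS

end Literature.Analysis.FluidPDE

/-!
# Part 2 — assembly: discharge of the named fact `NS.hopf_galerkin_limit`

Trunk: FluidKinetic. Assembly of the passage to the limit in Hopf's existence proof
(Robinson–Rodrigo–Sadowski 2016, Thm. 4.4 Steps 3–4, Thm. 4.6, Cor. 4.7, Thm. 4.11;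
Constantin–Foias 1988, Ch. 8, Theorem (Leray); Hopf 1951, §4) from its parts:

* `NSHopfLimit` — uniform bounds, equicontinuity, diagonal extraction; the limit field, Fatou for
  the dissipation, Friedrichs' inequality;
* `NSHopfEnergy` — energy inequalities, weak continuity, the energy class;
* Part 1 of this module — the weak form of the equations for the limit;
* `NSHopfGalerkin` — `isLerayHopfOn_of_clauses` (strong attainment of the datum, RRS Cor. 4.7).

Main results: `NS.IsHopfGalerkinScheme.exists_isGlobalLerayHopf` (every Hopf–Galerkin scheme on
`T^d`, `ν > 0`, has a subsequence converging to a global Leray–Hopf weak solution) and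
`NS.hopf_galerkin_limit_holds : hopf_galerkin_limit` (the case `d = 3`).

## References

* E. Hopf, *Über die Anfangswertaufgabe für die hydrodynamischen Grundgleichungen*, Math. Nachr.
  4 (1951), 213–231, §4.
* J. C. Robinson, J. L. Rodrigo, W. Sadowski, *The three-dimensional Navier–Stokes equations*
  (CUP 2016), Thm. 4.4, Thm. 4.6, Cor. 4.7, Thm. 4.11.
* P. Constantin, C. Foias, *Navier–Stokes Equations* (Chicago 1988), Ch. 8, Theorem (Leray).
-/

open MeasureTheory TopologicalSpace Set Function Filter Topology UnitAddTorus
open scoped InnerProductSpace RealInnerProductSpace ENNReal NNReal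

namespace Literature.Analysis.FluidPDE

variable {d : Type*} [Fintype d] [DecidableEq d]

variable {ν : ℝ} {f : ℝ → UnitAddTorus d → EuclideanSpace ℝ d}
  {u₀ : UnitAddTorus d → EuclideanSpace ℝ d} {N : ℕ → ℕ}
  {F U : ℕ → ℝ → UnitAddTorus d → EuclideanSpace ℝ d}
  {u : ℝ → UnitAddTorus d → EuclideanSpace ℝ d}

/-- **A coefficientwise limit of a Hopf–Galerkin scheme is a Leray–Hopf weak solution on every
`[0, T)`** (Robinson–Rodrigo–Sadowski 2016, Thm. 4.4 Steps 3–4 with Thm. 4.6 and Cor. 4.7;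
Constantin–Foias 1988, Ch. 8, Theorem (Leray)): the eight clauses of `Torus.IsLerayHopfOn` for a
field `u` with `L²` slices, a.e. strongly measurable on `(0, ∞) × T^d`, to which the
approximations converge coefficientwise at every time (`ν > 0`). [cite: RobinsonRodrigoSadowski2016, Thm. 4.4 Steps 3–4] -/
theorem IsHopfGalerkinScheme.isLerayHopfOn_limit (hS : IsHopfGalerkinScheme ν f u₀ N F U)
    (hν : 0 < ν) (hu₀ : MemLp u₀ 2 volume) (hdiv : FunctionSpaces.Torus.IsWeaklyDivFree u₀)
    (hfm : AEStronglyMeasurable (FunctionSpaces.Torus.stLift f) (volume.restrict (Set.Ioi 0 ×ˢ Set.univ)))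
    (hf₂ : ∀ T, 0 < T → ∫⁻ t in Set.Ioo 0 T, ∫⁻ x, ‖f t x‖ₑ ^ 2 < ⊤)
    (hum : AEStronglyMeasurable (FunctionSpaces.Torus.stLift u) (volume.restrict (Set.Ioi 0 ×ˢ Set.univ)))
    (hu : ∀ t, 0 ≤ t → MemLp (u t) 2 volume)
    (hc : ∀ t, 0 ≤ t → ∀ k, Tendsto (fun n => mFourierCoeff (FunctionSpaces.EuclideanSpace.complexify ∘ U n t) k)
      atTop (𝓝 (mFourierCoeff (FunctionSpaces.EuclideanSpace.complexify ∘ u t) k))) {T : ℝ} (hT : 0 < T) :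
    Torus.IsLerayHopfOn T ν f u₀ u := by
  refine isLerayHopfOn_of_clauses hT hν.le hu₀ ?_ ?_ (fun t ht => hu t ht.1) ?_ ?_ ?_ ?_
  · -- the forced weak form
    refine ⟨hum.mono_measure (Measure.restrict_mono (Set.prod_mono Set.Ioo_subset_Ioi_self subset_rfl) le_rfl),
      hS.lintegral_limit_lt_top hν.le hu₀ hfm hf₂ hu hc hT, ?_, fun ψ hψ hψdiv => ?_⟩
    · filter_upwards [ae_restrict_mem measurableSet_Ioo] with t ht
      exact hS.isWeaklyDivFree_limit hu hc ht.1.le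
    · exact hS.weak_form_limit hν hu₀ hfm hf₂ hum hu hc hT hψ hψdiv
  · exact hS.energy_bound_limit hν.le hu₀ hfm hf₂ hu hc hT
  · exact hS.memL2Sobolev_limit hν hu₀ hfm hf₂ hum hu hc hT
  · exact fun t ht => hS.energy_ineq_zero_limit hν hu₀ hdiv hfm hf₂ hum hu hc hT ht
  · exact hS.energy_ineq_ae_limit hν hu₀ hfm hf₂ hum hu hc hT
  · intro w hw
    have hcont := hS.continuousOn_integral_inner_limit hν.le hu₀ hfm hf₂ hu hc hw
    refine ⟨hcont.mono fun t ht => Set.mem_Ici.2 ht.1.le, ?_⟩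
    have h0 : ∫ x, ⟪u 0 x, w x⟫ = ∫ x, ⟪u₀ x, w x⟫ := by
      refine integral_congr_ae ?_
      filter_upwards [hS.limit_zero_ae_eq hu₀ hdiv hu hc] with x hx
      rw [hx]
    rw [← h0]
    exact ((hcont 0 (Set.mem_Ici.2 le_rfl)).tendsto).mono_left (nhdsWithin_mono _ Set.Ioi_subset_Ici_self)

/-- **Every Hopf–Galerkin scheme has a subsequence converging to a global Leray–Hopf weak
solution** (general dimension `d`, `ν > 0`; Robinson–Rodrigo–Sadowski 2016, Thm. 4.4, Thm. 4.6,
Cor. 4.7, Thm. 4.11; Constantin–Foias 1988, Ch. 8, Theorem (Leray); Hopf 1951, §4): the limit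
field of `exists_limitField` along the extracted subsequence is Leray–Hopf on every `[0, T)`. [cite: RobinsonRodrigoSadowski2016, Thm. 4.4] -/
theorem IsHopfGalerkinScheme.exists_isGlobalLerayHopf (hS : IsHopfGalerkinScheme ν f u₀ N F U)
    (hν : 0 < ν) (hu₀ : MemLp u₀ 2 volume) (hdiv : FunctionSpaces.Torus.IsWeaklyDivFree u₀)
    (hfm : AEStronglyMeasurable (FunctionSpaces.Torus.stLift f) (volume.restrict (Set.Ioi 0 ×ˢ Set.univ)))
    (hf₂ : ∀ T, 0 < T → ∫⁻ t in Set.Ioo 0 T, ∫⁻ x, ‖f t x‖ₑ ^ 2 < ⊤) :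
    ∃ u : ℝ → UnitAddTorus d → EuclideanSpace ℝ d, Torus.IsGlobalLerayHopf ν f u₀ u := by
  obtain ⟨φ, hφ, u, hum, hu, hc⟩ := hS.exists_limitField hν.le hu₀ hfm hf₂
  exact ⟨u, fun T hT => (hS.comp_strictMono hφ).isLerayHopfOn_limit hν hu₀ hdiv hfm hf₂ hum hu hc hT⟩

/-- **Discharge of the named fact `NS.hopf_galerkin_limit`** (Robinson–Rodrigo–Sadowski 2016,
Thm. 4.4 Steps 3–4, Thm. 4.6, Cor. 4.7, Thm. 4.11; Constantin–Foias 1988, Ch. 8, Theorem (Leray);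
Hopf 1951, §4): on `𝕋³`, every Hopf–Galerkin scheme for `(ν, f, u₀)` as in
`hopf_existence_torus` yields a global Leray–Hopf weak solution. [cite: RobinsonRodrigoSadowski2016, Thm. 4.4 Steps 3–4, Thm. 4.6, Cor. 4.7, Thm. 4.11] -/
theorem hopf_galerkin_limit_holds : hopf_galerkin_limit :=
  fun _ν hν _u₀ hu₀ hdiv _f hf hf₂ _N _F _U hS => hS.exists_isGlobalLerayHopf hν hu₀ hdiv hf hf₂

end Literature.Analysis.FluidPDE

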